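import Mathlib
import HarnessLib
import HarnessLib.Audit
import Summits.ResolutionOfSingularities.Statement
import Summits.ResolutionOfSingularities.ResolutionOfSingularities.Theorems.FrobeniusSandwichClasses
import Literature.AlgebraicGeometry.Resolution.ProperModelsRegModel
import Literature.AlgebraicGeometry.Resolution.AlterationsSemiStable
import Literature.AlgebraicGeometry.Resolution.ProperModelsFunctionField
import Summits.ResolutionOfSingularities.ResolutionOfSingularities.Theorems.RadicandHessianClasses
import Summits.ResolutionOfSingularities.ResolutionOfSingularities.Theorems.RadicandIsolatedClasses
import Literature.AlgebraicGeometry.Resolution.ExcellentRings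
import Literature.AlgebraicGeometry.Resolution.BlowupSequences
import Literature.AlgebraicGeometry.Resolution.GabberTemkinAlterations
import Literature.AlgebraicGeometry.Resolution.ProjectiveModelsCharts
import Literature.AlgebraicGeometry.Resolution.AlterationsStrong
import HarnessLib.Audit.Status.Attr

/-!
Route: QuotientModels

# Route QuotientModels — resolution ⟸ sandwiched schemes resolve ∧ (Galois tower: port) ∧
Galois-fixed models ∧ height-one descent of models — the cell's MERGED gen-3 models-half child of
Dominance

It suffices to show X = SandwichedResolve ∧ GaloisTower ∧ GaloisFixedModels ∧ HeightOneDescent.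
SandwichedResolve (MR)
is the parent route Dominance's declared residual, re-asked with the IDENTICAL signature (item
stmt-ResolutionOfSingularities-24572; the gate deduplicates; declared residual of this route too,
score conceded). The other
three pieces carve the MODELS HALF of the summit — Zariski's RM = «every K/k essentially of finite
type with a proper model
has a REGULAR proper model» (∀ p, ProperModel.RegModel p; RM ⟹ Dominance.RegularRoofs; RM ⟸ ROOT by
the tree kernel
regModel_of_resolutionInChar) — BY THE TYPE OF THE DESCENT GROUP SCHEME: a regular model of an
arbitrary K/k (char p, ANY
field k) is reached from de Jong's REGULAR GALOIS ALTERATION K ⊆ K'^G ⊆ K' (which EXISTS by a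
theorem: GaloisTower C' =
de Jong 1997 Thm 5.13/(5.12.1)/Cor 5.15 + the elementary exponent-one tower K'^G ⊇ K·(K'^G)ᵖ ⊇ … ⊇ K
+ Module.Finite K K',
a PORT, derivation-free) by exactly one ÉTALE descent step (GaloisFixedModels E: regular proper
models descend through
quotients by finite groups acting with an equivariant regular proper model upstairs) and finitely
many HEIGHT-ONE radicial
steps (HeightOneDescent H: if K ⊆ L is finite with Lᵖ ⊆ K and L has a regular proper model then so
does K — lens-4 g3's
MinimalHeight signature as copied verbatim by lens-6 H1 and lens-1 rev 3). Exact bisections proved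
in the cell drafts (0
sorry): RM ⟺ E ∧ H modulo C' (regularModels_of_galoisTower, summit_iff' in QuotientModelsH1.lean;
regularModels_iff /
summit_iff in QuotientModels.lean for the derivation typing), the cross-kernel
pialtModels_of_galoisTower : C' → E →
PialtModels (lens-4's existence residual = p-alteration frontier Pialt, here DERIVED), lens-1's
summit_iff_pieces (ascent
form ROOT ⟺ MR ∧ PialtField ∧ SRM), flat radicial ladder and TWIST SQUARE SRM|perfect ⟺ ∀p H|perfect
(RadicialLadder.lean rev
3), lens-3's summit_iff_pieces (semistable side). No EQUIV layer. THE CELL'S ONE MERGED MODELS-HALF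
NODE (critic MERGE ruling
rows 19/20/22: trunk = lens-6 H1 DESCENT typing; lens-1 RadicialLadder (ascent), lens-3
SemistableModels (separable
degeneration) and lens-4 MinimalHeight material attach as asides), child of the cell's g0 route
route-ResolutionOfSingularities-Dominance on the MODELS side (its item RegularRoofs 24573 is implied
by RM).
Lean:
`Summit.ResolutionOfSingularities.ResolutionOfSingularities.Theses.QuotientModels.SandwichedResolve
∧ Summit.ResolutionOfSingularities.ResolutionOfSingularities.Theses.QuotientModels.GaloisTower ∧
Summit.ResolutionOfSingularities.ResolutionOfSingularities.Theses.QuotientModels.GaloisFixedModels ∧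
Summit.ResolutionOfSingularities.ResolutionOfSingularities.Theses.QuotientModels.HeightOneDescent`

## Assembly
The deciding theorem `closes (hS : SandwichedResolve) (hC : GaloisTower) (hE : GaloisFixedModels)
(hH : HeightOneDescent) :
_root_.ResolutionOfSingularities` is PROVED in glue.lean (≈ 125 lines, 0 sorry; body = lens-6
g3/glueH1.lean, certified pre-birth in
g3/glueH1_check.lean and re-checked by the writer with fully-qualified names, l6g3w/Test3.lean rc
0): (i) RM fieldwise from the tower —
Galois step by hE, exponent-one links by hH along Relation.ReflTransGen, last degenerate H-step
along K ≅ ι(K); (ii) an integral projective variety is joined (ProperModel.join) with the regular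
model of its function field, the join is sandwiched over the regular model, hS resolves it, push
down along joinFst
(ComponentGluing.Scheme.HasResolution.of_isBirational); (iii) reduction of ResolutionInChar p to
integral projective varieties by
ResolutionOverUpToDim.of_projective. All four binders are consumed.
Lean:
`Summit.ResolutionOfSingularities.ResolutionOfSingularities.Theses.QuotientModels.SandwichedResolve
→ Summit.ResolutionOfSingularities.ResolutionOfSingularities.Theses.QuotientModels.GaloisTower →
Summit.ResolutionOfSingularities.ResolutionOfSingularities.Theses.QuotientModels.GaloisFixedModels →
Summit.ResolutionOfSingularities.ResolutionOfSingularities.Theses.QuotientModels.HeightOneDescent →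
_root_.ResolutionOfSingularities`

Rationale: WHY THIS LINE. The cell's g0 route Dominance splits ROOT ⟺ RegularRoofs ∧ SandwichedResolve; its
residual MR is carried here verbatim
and conceded (score 0 on that axis; lenses 2/3/5/6-g2 decompose MR). This node attacks the OTHER
conjunct in Zariski's
models form RM, open from transcendence degree 4 in every characteristic p > 0, and is the first
node of the cell whose
open part is an EXACT two-open-piece bisection with neither piece known to be equivalent to its
parent: RM ⟺ E ∧ H
modulo the known C' (critic row 19: load-bearing both ways — drop E and C' ∧ H reaches only fields
below K' by height-one
steps, K'^G is not one; drop H and C' ∧ E gives exactly PialtModels, and PialtModels ⟹ RM by nothing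
known). The two
open pieces live in two different literatures with two different open cores: E in the
quotient-singularity /
equivariant-resolution literature (tame rung R1 KNOWN modulo the Bergh–Rydh port = tree
TameQuotientSingularitiesResolution;
linear p-groups R3 KNOWN by Kuniyoshi–Gaschütz–Miyata [arXiv:2010.01517 Thm 1.2]; open core R2 =
wild p-group actions with
non-linearisable fixed points; instruments: Kirally–Luetkebohmert residue-weighted games, Lorenzini
wild Z/p surface
quotients), H in the foliation / height-one inseparable-descent literature (R5 log-canonical KNOWN
modulo port:
Rudakov–Safarevic 1976, Posva arXiv:2311.16694 §2, Bergh–Rydh diagonalizable quotients; R4 rational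
kernels INSTRUMENTABLE
= census T-RR-bed's 11 open germs [census v3.2 sha256 0709ccf6…]; open core I_add = additive
foliation points in trdeg ≥ 4
[arXiv:2405.05735]). WHAT IS NEW (critic-confirmed against the tree): Pialt 0555 / PialtModels /
PialtPerfect are EXISTENCE
statements («a regular purely inseparable cover exists») with no attack short of resolution (Temkin
2017 = separable
p-alterations; Frobenius twist circular, barrier FrobeniusTwistResolution); E replaces existence by
DESCENT THROUGH A
FINITE GROUP from an object that exists by de Jong's theorem (PialtModels ⟸ C' ∧ E). Imported areas:
alterations (de Jong 1996/1997
[doi:10.5802/aif.1575]), Galois descent / quotient singularities (SGA1 V, Bergh–Rydh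
arXiv:1905.00872, Kollár), restricted
Lie algebras and 1-foliations (Jacobson, Rudakov–Safarevic, Ekedahl, Posva). TAGS (cell standard,
critic rows 19/20): C'
COSTUME(cite)/KNOWN; E, H WEAKER than S BY LETTER (models-type certificate inherited from RR: 𝒦_lin
— the E-instance is
Kuniyoshi's rationality theorem while WildQuotients.JordanBlockFourfold 17942 is open; rational
fourfolds for H) and
UNDECIDED versus RM (not certifiable by any class of fields); open cores R2 / H_add IDEA-NEEDED and
— after census T-RR-rho
[sha256 a2eac5b2…]: every held bed germ is vacuous-or-settled for the models half by torus splitting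
— INSTRUMENT-LESS on the
radicial side (critic note under rows 19–22: no evidence in print or on our beds that EXISTENCE of
regular proper models in
dimension 4 is hard; the live models-half instrument is T-E-1, wild Z/p actions with isolated
non-linearisable fixed points). MERGE (critic rows 19/20/22): lens-1
RadicialLadder = ASCENT form (SimpleRadicialRegModel, PialtField asides; SRM₄ the dim-4 rung,
IDEA-NEEDED; twist square
SRM|perfect ⟺ H|perfect PROVED), lens-3 SemistableModels = separable-degeneration side
(NodalFieldsRegular aside-crux over k̄,
NFR₄ ATTACKABLE closed-mod-library = the models side's first closable dim-4 rung;
P3/SeparableDescent alternative residual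
typing, banked), lens-4 MinimalHeight = source of H's signature and of PialtModels (its NODE line
was not yet posted /
judged at filing time: its p-Lie-type layer and its 03:54Z intermediate-field re-typing of H attach
post-birth at tenure).

RANKED CRUXES. #2 GaloisFixedModels (crux) — [TAGS · E · crux rank 2 · NECESSARY ✓
(galoisFixedModels_of_regularModels ∘ regularModels_of_summit) · WEAKER than S by letter (𝒦_lin: K'
= k(x₀..x₃), G = Z/p unipotent Jordan block, N' = P⁴ — E-instance KNOWN by Kuniyoshi–Gaschütz,
S-instance = WildQuotients.JordanBlockFourfold 17942 OPEN) · UNDECIDED vs RM · leaf IDEA-NEEDED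
(open core R2 PGroupFixedModels) / ATTACKABLE on R1 TameGaloisFixedModels, KNOWN on linear p-groups;
instrument T-E-1] For every field k of char p, every K'/k essentially of finite type, every finite
group G acting on K' by k-automorphisms and every REGULAR proper model N' of K' on which each ρ g
extends to an automorphism of N'.X over the generic point, the fixed field (an embedded K whose
range is the set of fixed elements, K with a proper model) has a REGULAR proper model. [difficulty:
open-problem] (why it might fail: a wild Z/p action on a regular proper fourfold model all of whose
equivariant models keep a non-linearisable fixed point and whose fixed field has no regular model —
none known; the plain Kirally–Luetkebohmert game cycles on A⁴/V₄ (kit j001300).)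
[doi:10.5802/aif.1575, arXiv:2010.01517, arXiv:1905.00872, Kollar2007]
#3 HeightOneDescent (crux) — [TAGS · H · crux rank 3 · = lens-4 g3 MinimalHeight.HeightOneDescent as
copied VERBATIM by lens-6 QuotientModelsH1 and lens-1 RadicialLadder rev 3 (one shared statement;
wrapped over all primes) · NECESSARY ✓ (heightOneDescent_of_regularModels) · WEAKER than S by letter
(rational fourfolds) · UNDECIDED vs RM · ≡ SimpleRadicialRegModel over PERFECT k (twist square
PROVED, RadicialLadder.lean rev 3 :812 ff) · leaf IDEA-NEEDED (open core: additive foliation points,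
trdeg ≥ 4) / KNOWN-mod-port on R5 LogCanonicalKernelModels · INSTRUMENT-LESS after census T-RR-rho]
For every field k of char p and every finite K ⊆ L essentially of finite type with Lᵖ ⊆ K: if L has
a REGULAR proper model then K has a REGULAR proper model (exponent-one purely inseparable DESCENT of
regular proper models). [difficulty: open-problem] (why it might fail: an exponent-one subfield K ⊇
Lᵖ of a regularly-modelled fourfold field L with no regular proper model — e.g. the kernel of an
ADDITIVE p-closed derivation (barrier BaseOnlyRadicialNormalizationCannot kills base-only normalised
blow-ups); no invariant known to drop in trdeg 4.) [arXiv:2405.05735, arXiv:2311.16694,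
RudakovSafarevic1976, doi:10.5802/aif.1575, CossartPiltant2019]
#4 SandwichedResolve (crux) — [TAGS · MR · crux rank 4 · SHARED with
route-ResolutionOfSingularities-Dominance (item stmt-ResolutionOfSingularities-24572, IDENTICAL
signature, deduplicated) · DECLARED RESIDUAL of this route (tribunal_fit.residual; Dominance
tribunal 02:36Z SPLIT-WITH-RESIDUAL) · UNDECIDED either way vs S (critic ERRATUM 02:58:05Z) · not
re-litigated here; decomposed by the cell's order / position / confinement children (OrderCut,
SpecialFibres→Iso₄, DeepSandwich)] Every reduced scheme separated, of finite type and BIRATIONAL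
over a REGULAR separated finite-type k-scheme Y has a resolution. [difficulty: open-problem] (why it
might fail: it is the summit's honest residual: in dimension 4 it contains the Cossart–Piltant
specimen chart and every fourfold birational over a regular fourfold; open.) [CossartPiltant2019,
Cutkosky2009, arXiv:math/0703678]
#9 GaloisTower (support) — [TAGS · C' · support · COSTUME(cite)/KNOWN: de Jong 1997 Thm 5.13
(5.12.1), Cor 5.15, Situation 5.3 [corpus:doi-10-5802-aif-1575 p.613, p.619–620] + the elementary
exponent-one tower of a finite purely inseparable extension · a PORT · derivation-free H1 form
(lens-6 QuotientModelsH1)] For every K/k essentially of finite type (char p, ANY k) there are a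
finite group G, a field K' ⊇ K essentially of finite type, FINITE over K, with a G-action by
k-automorphisms extending over the generic point to a REGULAR PROPER model N' of K', whose fixed
field K₁ = K'^G is essentially of finite type with a proper model and purely inseparable over K, and
a chain K₁ = F₀ ⊇ F₁ ⊇ … ⊇ K of subfields, each essentially of finite type with K' finite over it,
with Fᵢᵖ ⊆ Fᵢ₊₁. [difficulty: M] [doi:10.5802/aif.1575, Jacobson1964]
#9 RegularModels (support) — [TAGS · RM · aside · the exact parent of E ∧ H (regularModels_iff /
regularModels_of_galoisTower); lens-3 decl verbatim; Zariski 1944 form of the models half; ROOT ⟺ MR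
∧ RM] for every prime p, ProperModel.RegModel p. [difficulty: L] [doi:10.5802/aif.1575,
arXiv:2010.01517, arXiv:2311.16694, arXiv:1905.00872, CossartPiltant2019]
#9 PialtModels (support) — [TAGS · P · aside · lens-4 g3 MinimalHeight.PialtModels VERBATIM (all
fields) = p-alteration frontier Pialt 0555 in models typing; PROVED from C' ∧ E
(pialtModels_of_galoisTower) and from RM] every K/k essentially of finite type has a finite purely
inseparable extension with a regular proper model. [difficulty: L] [doi:10.5802/aif.1575,
arXiv:2010.01517, arXiv:2311.16694, arXiv:1905.00872, CossartPiltant2019]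
#9 SimpleRadicialRegModel (support) — [TAGS · SRM · aside · lens-1 g3 RadicialLadder crux in ASCENT
form (merge ruling row 20: aside of the trunk) · WEAKER vs S by letter (inherited) · UNDECIDED vs RM
· ≡ H over perfect k (twist square PROVED rev 3) · flat radicial ladder RadicialRegModelExp e ⟺ SRM
PROVED] K = L(a) with aᵖ ∈ L and L regularly modelled ⇒ K has a regular proper model. [difficulty:
L] [doi:10.5802/aif.1575, arXiv:2010.01517, arXiv:2311.16694, arXiv:1905.00872, CossartPiltant2019]
#9 PialtField (support) — [TAGS · aside · lens-1 g3 SUBFIELD shadow of 0555 · NECESSARY (L := K) ·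
UNDECIDED (reduces to C' ∧ E only over perfect k via the Frobenius twist; no known reduction over
imperfect k — merge ruling row 20 (ii))] every K with a proper model is finite purely inseparable
over SOME subfield L ⊇ k with a regular proper model. [difficulty: L] [doi:10.5802/aif.1575,
arXiv:2010.01517, arXiv:2311.16694, arXiv:1905.00872, CossartPiltant2019]
#9 SimpleRadicialRegModelDimFour (support) — [TAGS · SRM₄ · aside · the dim-4 rung of the radicial
side · IDEA-NEEDED (critic RETAG row 20: contains RegModel for every Zariski fourfold zᵖ =
f(x₁..x₄); no dim-4 engine; CP2008-I is the local degree-p precedent) · INSTRUMENT-LESS after census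
T-RR-rho (11-germ bed settled by torus splitting); rungs ≤ 3 KNOWN by name
(simpleRadicialRegModelDim_of_cossartPiltant2019)] SRM for proper models of dimension ≤ 4.
[difficulty: L] [doi:10.5802/aif.1575, arXiv:2010.01517, arXiv:2311.16694, arXiv:1905.00872,
CossartPiltant2019]
#9 NodalFieldsRegular (support) — [TAGS · NFR · aside-crux over k̄ · lens-3 g3 SemistableModels
(merge ruling row 22) · NECESSARY · WEAKER(structural: ⟸ log-resolution of the discriminant ONE
DIMENSION DOWN + flat base change + dJ96 3.2/4.24–4.28, uniformly in n) / UNDECIDED vs S_(n−1); the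
part of RM|k̄ that log-resolution one dimension down already pays for; predicate IsSemistableFibred
inlined] over algebraically closed k: a field with a proper model fibred in semistable curves over a
regular projective base (smooth off a proper closed subset) has a regular proper model. [difficulty:
L] [doi:10.5802/aif.1575, arXiv:2010.01517, arXiv:2311.16694, arXiv:1905.00872, CossartPiltant2019]
#9 NodalFieldsRegularDimFour (support) — [TAGS · NFR₄ · aside · ATTACKABLE closed-modulo-library
(critic row 22 ACCEPTED: ONE global CossartJannsenSaito2020Embedded call on the discriminant surface
in a regular projective threefold + base change + tree facts DeJong1996SemiStableCodimThree /
DeJong1996CodimThreeModification; no functoriality/gluing port) — the cell's third typed dim-4 rung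
and the FIRST ON THE MODELS SIDE; prover skeleton HOME/decomp-res-lens-3/g3/NFR4_skeleton.lean (3
stubs, composition kernel-checked)] NFR for semistable-fibred proper models of dimension ≤ 4.
[difficulty: L] [doi:10.5802/aif.1575, arXiv:2010.01517, arXiv:2311.16694, arXiv:1905.00872,
CossartPiltant2019]
#9 TameGaloisFixedModels (support) — [TAGS · R1 · aside · rung of E · KNOWN modulo port (N'/G
projective by SGA1 V.1 / Mumford AV §7; tame quotient singularities resolved by Bergh–Rydh Thm 5 =
tree fact BerghRydh2019_tameQuotientResolution) · ATTACKABLE] E restricted to p ∤ |G|, k perfect and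
N' PROJECTIVE. [difficulty: L] [doi:10.5802/aif.1575, arXiv:2010.01517, arXiv:2311.16694,
arXiv:1905.00872, CossartPiltant2019]
#9 PGroupFixedModels (support) — [TAGS · R2 · aside · the open core of E · IDEA-NEEDED (wild p-group
actions with non-linearisable fixed points on non-rational K'); instrument T-E-1] E restricted to
finite p-groups G. [difficulty: L] [doi:10.5802/aif.1575, arXiv:2010.01517, arXiv:2311.16694,
arXiv:1905.00872, CossartPiltant2019]
#9 LogCanonicalKernelModels (support) — [TAGS · R5 · aside · rung of H in derivation typing · KNOWN
modulo port (Rudakov–Safarevic 1976 Thm 1–2, Posva arXiv:2311.16694 §2, Artin 1969 Cor 2.6, tree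
fact BerghRydh2019_diagonalizableQuotientResolution; cf. FoliationDescent.LogCanQuotLU 17082)]
kernels of p-closed derivations with only non-singular or multiplicative points on a regular
projective model (k perfect) have regular proper models. [difficulty: L] [doi:10.5802/aif.1575,
arXiv:2010.01517, arXiv:2311.16694, arXiv:1905.00872, CossartPiltant2019]

TWO-LAYER PLAN. Foreseen glued splits (tenure, after the tribunal): GaloisFixedModels ⟸
TameGaloisFixedModels-type coprime step ∧ PGroupFixedModels is
NOT a valid split (coprime NON-normal descent of regular models unknown — repair census); the honest
children of E are by the
FIXED-POINT structure (linearisable / non-linearisable), linear p-groups the known rung.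
HeightOneDescent ⟸ LogCanonicalKernelModels (R5,
port) ∧ «additive points can be removed or made log-canonical on SOME regular model upstairs» (the
open core) — lens-4 g3's p-Lie-type
layer (multiplicative μ_p-type ⇒ toric ⇒ Kato1994) is that cut and attaches at tenure with its NODE.
Banked asides beyond the 15-item
cap (to hang by workitem add at tenure): LinearPGroupFixedModels (R3 KNOWN), RationalKernelModels
(R4, bed retired), RadicialRegModel (≡ SRM
PROVED), NormalTower / DerivationKernelModels / RadicialCoverModels (lens-6 derivation typing,
cleared row 19), SemistableAlterations (P1,
theorem mod de Jong), SemistableSeparableDescent / SeparableDescent (P3 alternative residual typing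
over k̄), lens-4's PialtModels-side layer.

KILL CRITERIA. A counterexample to E (a finite group action on a regular proper variety whose fixed
field has no regular proper model) or to I (a
p-closed derivation on a regularly-modelled K' whose kernel has none) refutes ROOT itself (both are
kernels-necessary), so the route
dies only with the summit; the LINE dies if the critic's merge ruling re-types the models half so
that E or I becomes decoration
(then re-glue), or if a tribunal shows E or I ≡ RM by a cheap argument (then the bisection is a
costume and the route retires
not-a-thesis on the models side, keeping MR).

NOT DECOMPOSED YET. R2 (wild core of E) and the additive core of H are named, not split; no third
layer. The residual MR is decomposed ELSEWHERE in the
cell (order / position / confinement children) and is not touched here. lens-4's Layer 2 (p-Lie type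
of the dual foliation) and
lens-1's exponent / p-rank collapse kernel are merge material, not items.

CHEAPEST FALSIFIER. Run E on the smallest wild case beyond Kuniyoshi: G = Z/p acting on a regular
proper model of a NON-rational K' of trdeg 4 with an
isolated non-linearisable fixed point (Lorenzini-type wild Z/p quotient one dimension up) — if the
fixed field provably has no regular
proper model the summit is false; if the Kirally–Luetkebohmert game terminates there (kit
j001394/j001400 terminate to first order on the
linear case) R2 gains its first rung. For H: the census T-RR-bed instrument is RETIRED (T-RR-rho:
all 11 germs settled by torus splitting); the first radicial
instrument is MODELS-BED-v0 M1–M5 (rank-5 exponent lattice, untested); NFR₄ is the cheapest closable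
rung (one CJS call, lens-3 skeleton).

NUMBERS. Census v3.2 (decomp-res-census-1 g3, sha256 md 0709ccf6…, json bc9f036a…): models half on
the wild ∧ dim ≥ 4 bed (59 germs): VACUOUS 35
/ SETTLED 13 / OPEN 11; kit j001300 (KL game cycles on A⁴/V₄), j001394 / j001400 (terminate to first
order). census T-RR-rho sha256 a2eac5b2… (models half: 113/113 bed germs
vacuous-or-settled). Items: 15 declared (3 open cruxes incl. the shared residual, 1 support port, 10
asides, 1 assembly).

DEFINITION REQUESTS. None: ProperModel, RegModel, Scheme.IsRegular, HasResolution, IsBirational are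
tree declarations (lean search --decl run by lens-6 and
re-run by the writer in Test.lean, rc 0).

Novelty: Searches RUN (lens-6 g0–g3): lit search --hybrid "Galois alteration regular quotient singularities
purely inseparable"; "Noether problem
p-group characteristic p rational Kuniyoshi"; "quotient singularities positive characteristic
resolution wild"; lit galaxy search
"Galois alteration|quotient singularities" --star all; "Kuniyoshi|Gaschütz"; tree rg
GaloisAlteration|fixedField|Kuniyoshi. Nearest prior
art FOUND: de Jong 1997 Cor 5.14/5.15 [corpus:doi-10-5802-aif-1575 p.619–620] («resolved up to
quotient singularities and a purely
inseparable extension») = exactly C; Bergh–Rydh [arXiv:1905.00872] tame quotients = R1;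
Kuniyoshi–Gaschütz [arXiv:2010.01517 Thm 1.2] = R3;
nobody states E (descent of REGULAR MODELS of the fixed field) as a step toward resolution in char
p. Nearest routes: SeparableGalois
descends RESOLUTIONS and keeps Pialt; WildQuotients 15640/17942 resolves the GIVEN quotient
(strictly above E on 𝒦_lin); FoliationDescent
is valuative (FolLU 17081 / LogCanQuotLU 17082) through the open PatchingRelPerfect 16161;
PAlteration keeps the existence piece Pialt 0555.
Delta in one sentence: the models half of resolution is bisected EXACTLY by the type of the descent
group scheme (étale E ∧ height-one
radicial H, modulo de Jong's regular Galois alteration), replacing the purely-inseparable-cover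
EXISTENCE frontier by Galois DESCENT from an object
that exists by theorem. Claimed grade: new-combination (critic row 19: «a genuine re-typing»).  [refs: 1905.00872, 2010.01517, doi-10-5802-aif-1575]

Barriers (technique_class: alterations, galois-descent, inseparable-descent, quotients): - technique_class: alterations, galois-descent, inseparable-descent, quotients
- Literature.Barriers.ResolutionOfSingularities.DimensionFourFrontier: it does not evade it; inside,
as every node of the cell — all open content starts at trdeg 4 (CossartPiltant2019 below).
- Literature.Barriers.ResolutionOfSingularities.FrobeniusTwistResolution: outside — one ground field
k throughout, REGULAR (not smooth) models, no Frobenius twist of the k-structure (the twist is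
exactly what C's de Jong alteration replaces).
- Literature.Barriers.ResolutionOfSingularities.InseparableBaseChangeResolution: outside — no base
change; E/H descend models inside a fixed K'/k.
- Literature.Barriers.ResolutionOfSingularities.InseparableBaseChangeNarrow: outside its class — the
structure morphism to the imperfect ground field k is RETAINED throughout (ProperModel k K, absolute
regularity Scheme.IsRegular of the models, never smoothness / geometric regularity over k, no base
change to k̄ or k^perf, no Galois descent from the algebraic closure): GaloisTower /
GaloisFixedModels / HeightOneDescent move between FIELDS K ⊆ K'^G ⊆ K' over the SAME k by finite
Galois quotients and exponent-one radicial steps of the function field (de Jong's alteration,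
evasion (vii) «inseparable alterations» of the entry), so the Liu 3.2.12-type witnesses (regular,
not geometrically regular) are models we accept, not obstructions.
- Literature.Barriers.ResolutionOfSingularities.RegularNotGeometricallyRegular: outside — regular

History (route lifecycle, newest last):
- 2026-08-30T04:28:41Z · rev 2: informal re-worded for HeightOneDescent (planner-decomp-res-writer-1-g2-0)
- 2026-08-30T05:53:34Z · rev 3: dropped LogCanonicalKernelModels — writer decomp-res-writer-1 g3: bookkeeping repair flagged by lens-1 g5 (WRITER.md §bookkeeping) and CRITIC row 37 (iv): item 27206 LogCanonicalKernelModels was (planner-decomp-res-writer-1-g3-0)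
- 2026-08-30T06:00:16Z · rev 4: informal re-worded for SimpleRadicialRegModelDimFour (planner-decomp-res-writer-1-g3-0)
- 2026-08-30T06:42:35Z · rev 5: informal re-worded for HyperbolicRadicands, RankOneRadicands, DegenerateRadicands (planner-decomp-res-writer-1-g3-0)
- 2026-08-30T07:03:34Z · rev 6: informal re-worded for GaloisFixedModels (planner-decomp-res-writer-1-g3-0)
- 2026-08-30T07:54:17Z · rev 7: informal re-worded for HeightOneDescent (planner-decomp-res-writer-1-g3-0)

sub-problem: ResolutionOfSingularities · status: draft · opened planner-decomp-res-writer-1-g0-0 2026-08-30T03:58:59Z · rev 7 · ledger route-ResolutionOfSingularities-QuotientModels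
GENERATED by the gate from the ledger (D-0016/17). Provers cite these decls: `theorem foo : Summit.ResolutionOfSingularities.ResolutionOfSingularities.Theses.QuotientModels.<Decl> := …` in Summits/ResolutionOfSingularities/ResolutionOfSingularities/Theorems/<Name>.lean.
-/

namespace Summit.ResolutionOfSingularities.ResolutionOfSingularities.Theses.QuotientModels

open scoped BigOperators Topology Manifold Classical MeasureTheory ProbabilityTheory Matrix InnerProductSpace ComplexConjugate ContinuousMap
open Filter Set Function TopologicalSpace MeasureTheory

attribute [summit_statement] _root_.ResolutionOfSingularities

/-- item stmt-ResolutionOfSingularities-27194 · crux · rank 2 · open · by planner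
why it might fail: a wild Z/p action on a regular proper fourfold model all of whose equivariant models keep a non-linearisable fixed point and whose fixed field has no regular model — none known; the plain Kirally–Luetkebohmert game cycles on A⁴/V₄ (kit j001300).
sources: doi:10.5802/aif.1575, arXiv:2010.01517, arXiv:1905.00872, Kollar2007
[TAGS · E · crux rank 2 · NECESSARY ✓ (galoisFixedModels_of_regularModels ∘ regularModels_of_summit)
· WEAKER than S by letter (𝒦_lin: K' = k(x₀..x₃), G = Z/p unipotent Jordan block, N' = P⁴ —
E-instance KNOWN by Kuniyoshi–Gaschütz, S-instance = WildQuotients.JordanBlockFourfold 17942 OPEN) ·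
UNDECIDED vs RM · EXACT SPLIT (lens-6 g7 TameDistillation, CRITIC row 45 «CLEARED AS MAP NODE»): E ⟺
PGroupFixedModels 27205 ∧ SylowDescent (this route's aside; kernel
Theorems.QuotientModelsTameDistillation.galoisFixedModels_iff) — the Sylow distillation: restrict
the roof to a Sylow p-subgroup (27205), then descend the coprime NON-normal index (SylowDescent);
«Tame 27204 ∧ PGroup 27205» remains NOT a valid split · leaf IDEA-NEEDED (open core R2
PGroupFixedModels; SylowDescent glue-typed, no engine) / ATTACKABLE on R1 TameGaloisFixedModels,
KNOWN on linear p-groups; instruments T-E-1, T-SD-1] For every field k of char p, every K'/k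
essentially of finite type, every finite group G acting on K' by k-automorphisms and every REGULAR
proper model N' of K' on which each ρ g extends to an automorphism of N'.X over the generic point,
the fixed field (an embedded K whose range is the set of fixed elem -/
@[route_item "route-ResolutionOfSingularities-QuotientModels", crux]
def GaloisFixedModels : Prop :=
  ∀ p : ℕ, p.Prime → ∀ (k : Type) [Field k] [CharP k p] (K' : Type) [Field K'] [Algebra k K'] [Algebra.EssFiniteType k K'] (G : Type) [Group G] [Finite G] (ρ : G →* (K' ≃ₐ[k] K')) (N' : Literature.AlgebraicGeometry.Resolution.ProperModel k K'), Literature.AlgebraicGeometry.Resolution.Scheme.IsRegular N'.X → (∀ g : G, ∃ φ : N'.X ≅ N'.X, CategoryTheory.CategoryStruct.comp (AlgebraicGeometry.Spec.map (CommRingCat.ofHom (ρ g).toAlgHom.toRingHom)) N'.gen = CategoryTheory.CategoryStruct.comp N'.gen φ.hom) → ∀ (K : Type) [Field K] [Algebra k K] [Algebra.EssFiniteType k K] (ι : K →ₐ[k] K'), (∀ y : K', y ∈ Set.range ι ↔ ∀ g : G, ρ g y = y) → Nonempty (Literature.AlgebraicGeometry.Resolution.ProperModel k K) → ∃ N : Literature.AlgebraicGeometry.Resolution.ProperModel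 k K, Literature.AlgebraicGeometry.Resolution.Scheme.IsRegular N.X

/-- item stmt-ResolutionOfSingularities-27195 · crux · rank 3 · open · by planner
why it might fail: an exponent-one subfield K ⊇ Lᵖ of a regularly-modelled fourfold field L with no regular proper model — e.g. the kernel of an ADDITIVE p-closed derivation (barrier BaseOnlyRadicialNormalizationCannot kills base-only normalised blow-ups); no invariant known to drop in trdeg 4.
sources: arXiv:2405.05735, arXiv:2311.16694, RudakovSafarevic1976, doi:10.5802/aif.1575, CossartPiltant2019
[crux] [H · crux rank 3 · = lens-4 g3 MinimalHeight.HeightOneDescent, shared by QuotientModelsH1 /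
RadicialLadder · NECESSARY ✓ (kernel QuotientModelsMinimalHeight.heightOneDescent_of_regModel,
p760563) · EXACTNESS: RegModel p ⟺ PialtModels_p ∧ H_p over ALL fields (regModel_iff; RegularModels
27197 ⟺ PialtModels 27198 ∧ H) · WEAKER than S / RM BY LETTER only — substance UNDECIDED (critic
rows 30/37) · ≡ H° 27696 (ONE radical) · ≡ SimpleRadicialRegModel 27199 over PERFECT k · leaf
IDEA-NEEDED (open core: kernels of ADDITIVE p-closed derivations, trdeg ≥ 4; barrier
BaseOnlyRadicialNormalizationCannot) · REFINED by asides: LogCanonicalKernelModelsR5 28815 (local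
foliation type), radicand cuts 28911–28914 / 29578–29583, TameDistillation 29860–29862, and the
FROBENIUS SANDWICH LADDER (lens-5 g8, CRITIC row 50, map node): RatSandwichRegModelsFourOne ⊇
RatIndexPDescentFour (census rung RatH1D₄; first open cell (4,1)), RatSandwichRegModelsFourTwo
(located envelope), bridge SandwichHeightOneDescentFour = H|sandwich (credit 0), asymptote
PIUnirationalRegModelsFour ⟺ ∀ m FS 4 m (EXACT); complement (non-p.i.-unirational tops) = unlocated
residual] -/
@[route_item "route-ResolutionOfSingularities-QuotientModels", crux]
def HeightOneDescent : Prop :=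
  ∀ p : ℕ, p.Prime → ∀ (k : Type) [Field k] [CharP k p] (K L : Type) [Field K] [Field L] [Algebra k K] [Algebra k L] [Algebra K L] [IsScalarTower k K L] [Algebra.EssFiniteType k K] [Module.Finite K L], (∀ x : L, x ^ p ∈ (algebraMap K L).range) → (∃ N : Literature.AlgebraicGeometry.Resolution.ProperModel k L, Literature.AlgebraicGeometry.Resolution.Scheme.IsRegular N.X) → ∃ N : Literature.AlgebraicGeometry.Resolution.ProperModel k K, Literature.AlgebraicGeometry.Resolution.Scheme.IsRegular N.X

/-- item stmt-ResolutionOfSingularities-24572 · crux · rank 4 · open · by planner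
why it might fail: it is the summit's honest residual: in dimension 4 it contains the Cossart–Piltant specimen chart and every fourfold birational over a regular fourfold; open.
sources: CossartPiltant2019, Cutkosky2009, arXiv:math/0703678
[crux] for every prime p, field k of characteristic p, regular separated finite-type k-scheme Y and
reduced scheme Γ with a separated finite-type BIRATIONAL morphism b : Γ ⟶ Y, the scheme Γ has a
resolution of singularities (MR: dominance without principalization; necessity kernel
`sandwichedResolve_of_summit`). BOOKING (critic decomp-res-crit-1 row 6 + ERRATUM 02:58Z; tribunal
census-trib-res-1 02:36Z SPLIT-WITH-RESIDUAL): the route's DECLARED RESIDUAL — NECESSARY ✓ ·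
UNDECIDED(costume-risk) both ways: MR ⟹ S unknown (absorption = RegularRoofs, open), S ⟹ MR kernel;
FUNCTORIALLY summit-equivalent two dimensions down (𝔾_m-fixed-locus certificate: an
equivariant/functorial proof of MR_m resolves every (m−2)-dimensional hypersurface), bare transfer
open; the one-dimension-down reading via the suspension Q_(h,N) = {u·x₁^N = h} is WITHDRAWN (no
descent to Cartier slices in char p) while MR ⊇ Q_(h,N) ⊇ the Cossart–Piltant Remark 3.2 fourfold
stands; no separating class can exist inside MR's scope (the scope certificate — cones over
non-ruled V — lies outside it); census T-MR-lin (kit j337538): all 25 print-hard wild dim ≥ 4 germs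
lie in MR proper, outside R2. ORDER CERTIFICATE in tree: -/
@[route_item "route-ResolutionOfSingularities-QuotientModels", crux]
def SandwichedResolve : Prop :=
  ∀ p : ℕ, p.Prime → ∀ (k : Type) [Field k] [CharP k p] (Y : AlgebraicGeometry.Scheme.{0}) (g : Y ⟶ AlgebraicGeometry.Spec (.of k)), AlgebraicGeometry.IsSeparated g → AlgebraicGeometry.LocallyOfFiniteType g → AlgebraicGeometry.QuasiCompact g → Literature.AlgebraicGeometry.Resolution.Scheme.IsRegular Y → ∀ (Γ : AlgebraicGeometry.Scheme.{0}) (b : Γ ⟶ Y), AlgebraicGeometry.IsSeparated b → AlgebraicGeometry.LocallyOfFiniteType b → AlgebraicGeometry.QuasiCompact b → Literature.AlgebraicGeometry.Resolution.IsBirational b → AlgebraicGeometry.IsReduced Γ → Literature.AlgebraicGeometry.Resolution.Scheme.HasResolution Γ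

/-- item stmt-ResolutionOfSingularities-27196 · support · rank 9 · open · by planner
sources: doi:10.5802/aif.1575, Jacobson1964
[support] [TAGS · C' · support · COSTUME(cite)/KNOWN: de Jong 1997 Thm 5.13 (5.12.1), Cor 5.15,
Situation 5.3 [corpus:doi-10-5802-aif-1575 p.613, p.619–620] + the elementary exponent-one tower of
a finite purely inseparable extension · a PORT · derivation-free H1 form (lens-6 QuotientModelsH1)]
For every K/k essentially of finite type (char p, ANY k) there are a finite group G, a field K' ⊇ K
essentially of finite type, FINITE over K, with a G-action by k-automorphisms extending over the
generic point to a REGULAR PROPER model N' of K', whose fixed field K₁ = K'^G is essentially of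
finite type with a proper model and purely inseparable over K, and a chain K₁ = F₀ ⊇ F₁ ⊇ … ⊇ K of
subfields, each essentially of finite type with K' finite over it, with Fᵢᵖ ⊆ Fᵢ₊₁. [difficulty: M] -/
@[route_item "route-ResolutionOfSingularities-QuotientModels", crux]
def GaloisTower : Prop :=
  ∀ p : ℕ, p.Prime → ∀ (k : Type) [Field k] [CharP k p] (K : Type) [Field K] [Algebra k K] [Algebra.EssFiniteType k K], ∃ (K' : Type) (_ : Field K') (_ : Algebra k K') (_ : Algebra.EssFiniteType k K') (G : Type) (_ : Group G) (_ : Finite G) (ρ : G →* (K' ≃ₐ[k] K')) (N' : Literature.AlgebraicGeometry.Resolution.ProperModel k K') (K₁ : IntermediateField k K') (ι : K →ₐ[k] K'), Literature.AlgebraicGeometry.Resolution.Scheme.IsRegular N'.X ∧ (∀ g : G, ∃ φ : N'.X ≅ N'.X, CategoryTheory.CategoryStruct.comp (AlgebraicGeometry.Spec.map (CommRingCat.ofHom (ρ g).toAlgHom.toRingHom)) N'.gen = CategoryTheory.CategoryStruct.comp N'.gen φ.hom) ∧ (∀ y : K', y ∈ K₁ ↔ ∀ g : G, ρ g y = y)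 ∧ Algebra.EssFiniteType k K₁ ∧ Nonempty (Literature.AlgebraicGeometry.Resolution.ProperModel k K₁) ∧ ι.fieldRange ≤ K₁ ∧ (∀ y : K', y ∈ K₁ → ∃ m : ℕ, y ^ p ^ m ∈ ι.fieldRange) ∧ (letI := ι.toRingHom.toAlgebra; Module.Finite K K') ∧ Relation.ReflTransGen (fun F E : IntermediateField k K' => E ≤ F ∧ Algebra.EssFiniteType k E ∧ FiniteDimensional E K' ∧ ∀ x : K', x ∈ F → x ^ p ∈ E) K₁ ι.fieldRange

/-- item stmt-ResolutionOfSingularities-27197 · aside · rank 9 · open · by planner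
sources: doi:10.5802/aif.1575, arXiv:2010.01517, arXiv:2311.16694, arXiv:1905.00872, CossartPiltant2019
[support] [TAGS · RM · aside · the exact parent of E ∧ H (regularModels_iff /
regularModels_of_galoisTower); lens-3 decl verbatim; Zariski 1944 form of the models half; ROOT ⟺ MR
∧ RM] for every prime p, ProperModel.RegModel p. [difficulty: L] -/
@[route_item "route-ResolutionOfSingularities-QuotientModels", crux]
def RegularModels : Prop :=
  ∀ p : ℕ, p.Prime → Literature.AlgebraicGeometry.Resolution.ProperModel.RegModel.{0} p

/-- item stmt-ResolutionOfSingularities-27198 · aside · rank 9 · open · by planner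
sources: doi:10.5802/aif.1575, arXiv:2010.01517, arXiv:2311.16694, arXiv:1905.00872, CossartPiltant2019
[support] [TAGS · P · aside · lens-4 g3 MinimalHeight.PialtModels VERBATIM (all fields) =
p-alteration frontier Pialt 0555 in models typing; PROVED from C' ∧ E (pialtModels_of_galoisTower)
and from RM] every K/k essentially of finite type has a finite purely inseparable extension with a
regular proper model. [difficulty: L] -/
@[route_item "route-ResolutionOfSingularities-QuotientModels", crux]
def PialtModels : Prop :=
  ∀ p : ℕ, p.Prime → ∀ (k : Type) [Field k] [CharP k p] (K : Type) [Field K] [Algebra k K] [Algebra.EssFiniteType k K], ∃ (L : Type) (_ : Field L) (_ : Algebra k L) (_ : Algebra K L) (_ : IsScalarTower k K L) (_ : Module.Finite K L) (_ : IsPurelyInseparable K L), ∃ N : Literature.AlgebraicGeometry.Resolution.ProperModel k L, Literature.AlgebraicGeometry.Resolution.Scheme.IsRegular N.X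

/-- item stmt-ResolutionOfSingularities-27199 · aside · rank 9 · open · by planner
sources: doi:10.5802/aif.1575, arXiv:2010.01517, arXiv:2311.16694, arXiv:1905.00872, CossartPiltant2019
[support] [TAGS · SRM · aside · lens-1 g3 RadicialLadder crux in ASCENT form (merge ruling row 20:
aside of the trunk) · WEAKER vs S by letter (inherited) · UNDECIDED vs RM · ≡ H over perfect k
(twist square PROVED rev 3) · flat radicial ladder RadicialRegModelExp e ⟺ SRM PROVED] K = L(a) with
aᵖ ∈ L and L regularly modelled ⇒ K has a regular proper model. [difficulty: L] -/
@[route_item "route-ResolutionOfSingularities-QuotientModels"]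
def SimpleRadicialRegModel : Prop :=
  ∀ p : ℕ, p.Prime → ∀ (k : Type) [Field k] [CharP k p] (L K : Type) [Field L] [Field K] [Algebra k L] [Algebra k K] [Algebra L K] [IsScalarTower k L K] (a : K), a ^ p ∈ (algebraMap L K).range → IntermediateField.adjoin L {a} = ⊤ → (∃ N : Literature.AlgebraicGeometry.Resolution.ProperModel.{0} k L, Literature.AlgebraicGeometry.Resolution.Scheme.IsRegular N.X) → ∃ M : Literature.AlgebraicGeometry.Resolution.ProperModel.{0} k K, Literature.AlgebraicGeometry.Resolution.Scheme.IsRegular M.X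

/-- item stmt-ResolutionOfSingularities-27200 · aside · rank 9 · open · by planner
sources: doi:10.5802/aif.1575, arXiv:2010.01517, arXiv:2311.16694, arXiv:1905.00872, CossartPiltant2019
[support] [TAGS · aside · lens-1 g3 SUBFIELD shadow of 0555 · NECESSARY (L := K) · UNDECIDED
(reduces to C' ∧ E only over perfect k via the Frobenius twist; no known reduction over imperfect k
— merge ruling row 20 (ii))] every K with a proper model is finite purely inseparable over SOME
subfield L ⊇ k with a regular proper model. [difficulty: L] -/
@[route_item "route-ResolutionOfSingularities-QuotientModels"]
def PialtField : Prop :=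
  ∀ p : ℕ, p.Prime → ∀ (k : Type) [Field k] [CharP k p] (K : Type) [Field K] [Algebra k K] [Algebra.EssFiniteType k K], Nonempty (Literature.AlgebraicGeometry.Resolution.ProperModel.{0} k K) → ∃ (L : Type) (_ : Field L) (_ : Algebra k L) (_ : Algebra L K) (_ : IsScalarTower k L K), FiniteDimensional L K ∧ IsPurelyInseparable L K ∧ ∃ N : Literature.AlgebraicGeometry.Resolution.ProperModel.{0} k L, Literature.AlgebraicGeometry.Resolution.Scheme.IsRegular N.X

/-- item stmt-ResolutionOfSingularities-27201 · aside · rank 9 · open · by planner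
sources: doi:10.5802/aif.1575, arXiv:2010.01517, arXiv:2311.16694, arXiv:1905.00872, CossartPiltant2019
[support] [TAGS · SRM₄ · aside · the dim-4 rung of the radicial side · IDEA-NEEDED (critic RETAG row
20: contains RegModel for every Zariski fourfold zᵖ = f(x₁..x₄); no dim-4 engine; CP2008-I is the
local degree-p precedent) · INSTRUMENT-LESS after census T-RR-rho; rungs ≤ 3 KNOWN by name
(simpleRadicialRegModelDim_of_cossartPiltant2019)] [BOOKED 2026-08-30 lens-1 g5 HessianLadder rev 2,
CRITIC row 37 CLEARED AS CHILD NODE: EXACT 4-way cut by the Hessian/polar RANK of the radicand at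
closed critical points — SRM₄ ⟺ TameRadicands [KNOWN-MOD-PORT, first decided FUNCTION-FIELD rung
beyond the torus classes] ∧ HyperbolicRadicands [UNDECIDED(T-hyp-descent), small located descent
seam] ∧ RankOneRadicands [UNDECIDED: ERes of Zariski threefold germs in regular 4-space] ∧
DegenerateRadicands [declared residual, score 0, not absorbing] (asides on this route over
Theorems/RadicandHessianClasses.lean; by-name kernels srm4_iff / closes / srm4_of_root in
Theorems/QuotientModelsHessianLadder.lean)] SRM for proper models of dimension ≤ 4. [difficulty: L] -/
@[route_item "route-ResolutionOfSingularities-QuotientModels", crux]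
def SimpleRadicialRegModelDimFour : Prop :=
  ∀ p : ℕ, p.Prime → ∀ (k : Type) [Field k] [CharP k p] (L K : Type) [Field L] [Field K] [Algebra k L] [Algebra k K] [Algebra L K] [IsScalarTower k L K] (a : K), a ^ p ∈ (algebraMap L K).range → IntermediateField.adjoin L {a} = ⊤ → (∃ N : Literature.AlgebraicGeometry.Resolution.ProperModel.{0} k L, Literature.AlgebraicGeometry.Resolution.Scheme.IsRegular N.X) → ∀ M : Literature.AlgebraicGeometry.Resolution.ProperModel.{0} k K, topologicalKrullDim M.X ≤ 4 → ∃ M' : Literature.AlgebraicGeometry.Resolution.ProperModel.{0} k K, Literature.AlgebraicGeometry.Resolution.Scheme.IsRegular M'.X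

/-- item stmt-ResolutionOfSingularities-27202 · aside · rank 9 · open · by planner
sources: doi:10.5802/aif.1575, arXiv:2010.01517, arXiv:2311.16694, arXiv:1905.00872, CossartPiltant2019
[support] [TAGS · NFR · aside-crux over k̄ · lens-3 g3 SemistableModels (merge ruling row 22) ·
NECESSARY · WEAKER(structural: ⟸ log-resolution of the discriminant ONE DIMENSION DOWN + flat base
change + dJ96 3.2/4.24–4.28, uniformly in n) / UNDECIDED vs S_(n−1); the part of RM|k̄ that
log-resolution one dimension down already pays for; predicate IsSemistableFibred inlined] over
algebraically closed k: a field with a proper model fibred in semistable curves over a regular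
projective base (smooth off a proper closed subset) has a regular proper model. [difficulty: L] -/
@[route_item "route-ResolutionOfSingularities-QuotientModels"]
def NodalFieldsRegular : Prop :=
  ∀ p : ℕ, p.Prime → ∀ (k : Type) [Field k] [CharP k p] [IsAlgClosed k] (L : Type) [Field L] [Algebra k L] (M : Literature.AlgebraicGeometry.Resolution.ProperModel k L), (∃ (Y : AlgebraicGeometry.Scheme.{0}) (f : M.X ⟶ Y) (g : Y ⟶ AlgebraicGeometry.Spec (.of k)) (U : Y.Opens), CategoryTheory.CategoryStruct.comp f g = M.π ∧ AlgebraicGeometry.IsIntegral Y ∧ Literature.AlgebraicGeometry.Motives.IsProjectiveOver (CategoryTheory.Over.mk g) ∧ Literature.AlgebraicGeometry.Resolution.Scheme.IsRegular Y ∧ Literature.AlgebraicGeometry.Motives.IsProjectiveOver (CategoryTheory.Over.mk M.π) ∧ (U : Set Y).Nonempty ∧ Literature.AlgebraicGeometry.Resolution.IsSemiStableCurve f ∧ AlgebraicGeometry.Smooth (AlgebraicGeometry.morphismRestrict f U)) → ∃ N : Literature.AlgebraicGeometry.Resolution.ProperModel k L, Literature.AlgebraicGeometry.Resolution.Scheme.IsRegular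 N.X

/-- item stmt-ResolutionOfSingularities-27203 · aside · rank 9 · open · by planner
sources: doi:10.5802/aif.1575, arXiv:2010.01517, arXiv:2311.16694, arXiv:1905.00872, CossartPiltant2019
[support] [TAGS · NFR₄ · aside · ATTACKABLE closed-modulo-library (critic row 22 ACCEPTED: ONE
global CossartJannsenSaito2020Embedded call on the discriminant surface in a regular projective
threefold + base change + tree facts DeJong1996SemiStableCodimThree /
DeJong1996CodimThreeModification; no functoriality/gluing port) — the cell's third typed dim-4 rung
and the FIRST ON THE MODELS SIDE; prover skeleton HOME/decomp-res-lens-3/g3/NFR4_skeleton.lean (3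
stubs, composition kernel-checked)] NFR for semistable-fibred proper models of dimension ≤ 4.
[difficulty: L] -/
@[route_item "route-ResolutionOfSingularities-QuotientModels"]
def NodalFieldsRegularDimFour : Prop :=
  ∀ p : ℕ, p.Prime → ∀ (k : Type) [Field k] [CharP k p] [IsAlgClosed k] (L : Type) [Field L] [Algebra k L] (M : Literature.AlgebraicGeometry.Resolution.ProperModel k L), topologicalKrullDim M.X ≤ 4 → (∃ (Y : AlgebraicGeometry.Scheme.{0}) (f : M.X ⟶ Y) (g : Y ⟶ AlgebraicGeometry.Spec (.of k)) (U : Y.Opens), CategoryTheory.CategoryStruct.comp f g = M.π ∧ AlgebraicGeometry.IsIntegral Y ∧ Literature.AlgebraicGeometry.Motives.IsProjectiveOver (CategoryTheory.Over.mk g) ∧ Literature.AlgebraicGeometry.Resolution.Scheme.IsRegular Y ∧ Literature.AlgebraicGeometry.Motives.IsProjectiveOver (CategoryTheory.Over.mk M.π) ∧ (U : Set Y).Nonempty ∧ Literature.AlgebraicGeometry.Resolution.IsSemiStableCurve f ∧ AlgebraicGeometry.Smooth (AlgebraicGeometry.morphismRestrict f U)) → ∃ N : Literature.AlgebraicGeometry.Resolution.ProperModel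 k L, Literature.AlgebraicGeometry.Resolution.Scheme.IsRegular N.X

/-- item stmt-ResolutionOfSingularities-27204 · aside · rank 9 · open · by planner
sources: doi:10.5802/aif.1575, arXiv:2010.01517, arXiv:2311.16694, arXiv:1905.00872, CossartPiltant2019
[support] [TAGS · R1 · aside · rung of E · KNOWN modulo port (N'/G projective by SGA1 V.1 / Mumford
AV §7; tame quotient singularities resolved by Bergh–Rydh Thm 5 = tree fact
BerghRydh2019_tameQuotientResolution) · ATTACKABLE] E restricted to p ∤ |G|, k perfect and N'
PROJECTIVE. [difficulty: L] -/
@[route_item "route-ResolutionOfSingularities-QuotientModels"]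
def TameGaloisFixedModels : Prop :=
  ∀ p : ℕ, p.Prime → ∀ (k : Type) [Field k] [CharP k p] [PerfectField k] (K' : Type) [Field K'] [Algebra k K'] [Algebra.EssFiniteType k K'] (G : Type) [Group G] [Finite G] (ρ : G →* (K' ≃ₐ[k] K')) (N' : Literature.AlgebraicGeometry.Resolution.ProperModel k K'), (Nat.card G).Coprime p → Literature.AlgebraicGeometry.Motives.IsProjectiveOver (CategoryTheory.Over.mk N'.π) → Literature.AlgebraicGeometry.Resolution.Scheme.IsRegular N'.X → (∀ g : G, ∃ φ : N'.X ≅ N'.X, CategoryTheory.CategoryStruct.comp (AlgebraicGeometry.Spec.map (CommRingCat.ofHom (ρ g).toAlgHom.toRingHom)) N'.gen = CategoryTheory.CategoryStruct.comp N'.gen φ.hom) → ∀ (K : Type) [Field K] [Algebra k K] [Algebra.EssFiniteType k K] (ι : K →ₐ[k] K'), (∀ y : K', y ∈ Set.range ι ↔ ∀ g : G, ρ g y = y) → Nonempty (Literature.AlgebraicGeometry.Resolution.ProperModel k K) → ∃ N : Literature.AlgebraicGeometry.Resolution.ProperModel k K, Literature.AlgebraicGeometry.Resolution.Scheme.IsRegular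 N.X

/-- item stmt-ResolutionOfSingularities-27205 · aside · rank 9 · open · by planner
sources: doi:10.5802/aif.1575, arXiv:2010.01517, arXiv:2311.16694, arXiv:1905.00872, CossartPiltant2019
[support] [TAGS · R2 · aside · the open core of E · IDEA-NEEDED (wild p-group actions with
non-linearisable fixed points on non-rational K'); instrument T-E-1] E restricted to finite p-groups
G. [difficulty: L] -/
@[route_item "route-ResolutionOfSingularities-QuotientModels"]
def PGroupFixedModels : Prop :=
  ∀ p : ℕ, p.Prime → ∀ (k : Type) [Field k] [CharP k p] (K' : Type) [Field K'] [Algebra k K'] [Algebra.EssFiniteType k K'] (G : Type) [Group G] [Finite G] (ρ : G →* (K' ≃ₐ[k] K')) (N' : Literature.AlgebraicGeometry.Resolution.ProperModel k K'), IsPGroup p G → Literature.AlgebraicGeometry.Resolution.Scheme.IsRegular N'.X → (∀ g : G, ∃ φ : N'.X ≅ N'.X, CategoryTheory.CategoryStruct.comp (AlgebraicGeometry.Spec.map (CommRingCat.ofHom (ρ g).toAlgHom.toRingHom)) N'.gen = CategoryTheory.CategoryStruct.comp N'.gen φ.hom) → ∀ (K : Type) [Field K] [Algebra k K] [Algebra.EssFiniteType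 k K] (ι : K →ₐ[k] K'), (∀ y : K', y ∈ Set.range ι ↔ ∀ g : G, ρ g y = y) → Nonempty (Literature.AlgebraicGeometry.Resolution.ProperModel k K) → ∃ N : Literature.AlgebraicGeometry.Resolution.ProperModel k K, Literature.AlgebraicGeometry.Resolution.Scheme.IsRegular N.X

/-- item stmt-ResolutionOfSingularities-27696 · aside · rank 9 · open · by planner
sources: arXiv:0804.1554, arXiv:1508.06255, RudakovSafarevic1976, doi:10.5802/aif.1575, arXiv:2405.05735
[support] [TAGS · H° · aside (outside the cone of closes; NAMED-RUNG RULE) · ≡ H = HeightOneDescent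
27195 at every prime (kernel `Theorems.QuotientModelsMinimalHeight.heightOneDescentAt_iff_simple` /
route-level `heightOneDescent_iff_simple`, lens-4 g3 MinimalHeight, land files
QuotientModelsMinimalHeightTower (p760563) + QuotientModelsMinimalHeight; this decl = `∀ p, p.Prime
→ HeightOneDescentSimpleAt p` verbatim) · critic row 37: WEAKER than S by letter · UNDECIDED vs RM ·
test bed = rational fourfolds (no separating class granted) · the ATOMIC form of the crux: a prover
of 27195 may prove H° and conclude by the kernel] ONE-RADICAL DESCENT: for every prime p, field k of
char p and K ⊆ L = K(x) essentially of finite type over k with x^p ∈ K and [L : K] finite: if L has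
a REGULAR proper k-model then so has K (Jacobson exponent-one theory: K = L^δ for ONE p-closed
derivation δ, so K-models are quotients of regular L-models by one p-closed rational vector field;
open core = ADDITIVE δ, trdeg ≥ 4). [difficulty: open-problem] -/
@[route_item "route-ResolutionOfSingularities-QuotientModels"]
def HeightOneDescentSimple : Prop :=
  ∀ p : ℕ, p.Prime → ∀ (k : Type) [Field k] [CharP k p] (K L : Type) [Field K] [Field L] [Algebra k K] [Algebra k L] [Algebra K L] [IsScalarTower k K L] [Algebra.EssFiniteType k K] [Module.Finite K L] (x : L), x ^ p ∈ (algebraMap K L).range → IntermediateField.adjoin K {x} = ⊤ → (∃ N : Literature.AlgebraicGeometry.Resolution.ProperModel k L, Literature.AlgebraicGeometry.Resolution.Scheme.IsRegular N.X) → ∃ N : Literature.AlgebraicGeometry.Resolution.ProperModel k K, Literature.AlgebraicGeometry.Resolution.Scheme.IsRegular N.X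

/-- item stmt-ResolutionOfSingularities-28815 · aside · rank 9 · open · by planner
sources: doi:10.5802/aif.1575, arXiv:2010.01517, arXiv:2311.16694, arXiv:1905.00872, CossartPiltant2019
[aside · R5 · rung of H in derivation typing · KNOWN modulo port (Rudakov–Safarevic 1976 Thm 1–2,
Posva arXiv:2311.16694 §2, Artin 1969 Cor 2.6, tree fact
BerghRydh2019_diagonalizableQuotientResolution; cf. FoliationDescent.LogCanQuotLU 17082) · REPLACES
item 27206 LogCanonicalKernelModels, whose filed signature was the route Assembly by a writer-g0
build slip (dropped in the same edit; lens-1 g5 WRITER.md / CRITIC row 37 (iv))] kernels of p-closed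
derivations D on K' (k perfect) with only NON-SINGULAR or MULTIPLICATIVE points on a regular
projective model N' of K' (locally D = g·D₀ with D₀ having a unit value or D₀^p = u·D₀, u a unit)
have regular proper models of the kernel field K = K'^D. [difficulty: L] -/
@[route_item "route-ResolutionOfSingularities-QuotientModels"]
def LogCanonicalKernelModelsR5 : Prop :=
  ∀ p : ℕ, p.Prime → ∀ (k : Type) [Field k] [CharP k p] [PerfectField k] (K' : Type) [Field K'] [Algebra k K'] [Algebra.EssFiniteType k K'] (N' : Literature.AlgebraicGeometry.Resolution.ProperModel k K'), Literature.AlgebraicGeometry.Motives.IsProjectiveOver (CategoryTheory.Over.mk N'.π) → Literature.AlgebraicGeometry.Resolution.Scheme.IsRegular N'.X → ∀ (D : Derivation k K' K'), D ≠ 0 → (∃ c : K', ∀ x : K', (⇑D)^[p] x = c * D x) → (∀ x : N'.X, ∃ g : K', g ≠ 0 ∧ (∀ f : N'.X.presheaf.stalk x, ∃ f' : N'.X.presheaf.stalk x, N'.funFieldAlgEquiv (algebraMap (N'.X.presheaf.stalk x) N'.X.functionField f') = g * D (N'.funFieldAlgEquiv (algebraMap (N'.X.presheaf.stalk x) N'.X.functionField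 f))) ∧ ((∃ f u : N'.X.presheaf.stalk x, IsUnit u ∧ N'.funFieldAlgEquiv (algebraMap (N'.X.presheaf.stalk x) N'.X.functionField u) = g * D (N'.funFieldAlgEquiv (algebraMap (N'.X.presheaf.stalk x) N'.X.functionField f))) ∨ (∃ u : N'.X.presheaf.stalk x, IsUnit u ∧ ∀ y : K', (fun z : K' => g * D z)^[p] y = N'.funFieldAlgEquiv (algebraMap (N'.X.presheaf.stalk x) N'.X.functionField u) * (g * D y)))) → ∀ (K : Type) [Field K] [Algebra k K] [Algebra.EssFiniteType k K] (ι : K →ₐ[k] K'), (∀ y : K', y ∈ Set.range ι ↔ D y = 0) → Nonempty (Literature.AlgebraicGeometry.Resolution.ProperModel k K) → ∃ N : Literature.AlgebraicGeometry.Resolution.ProperModel k K, Literature.AlgebraicGeometry.Resolution.Scheme.IsRegular N.X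

/-- item stmt-ResolutionOfSingularities-28911 · aside · rank 9 · open · by planner
sources: CossartPiltant2019, Kato1994, doi:10.5802/aif.1575
[aside · piece 0 of the Hessian-rank cut of SRM₄ 27201 (lens-1 g5 HessianLadder rev 2; CRITIC row 37
CLEARED AS CHILD NODE of QuotientModels:27201; defs Theorems/RadicandHessianClasses.lean) ·
WEAKER(evidence) = KNOWN-MOD-PORT: a decided FUNCTION-FIELD carving of the trdeg-4 simple-radicial
core (standard (e)(i); TameClass is a predicate on K/L, immune to DominationDichotomy) · engines in
tree: AdjoinRoot.isRegularLocalRing_X_pow_sub_C (level A), Kummer/log-regular +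
Kato1994_logRegular_hasResolution_holds (level B), dim ≤ 3 = CossartPiltant2019 (kernel
tameRadicands_of_core) · ONE PORT said: a GLOBAL log structure / restriction-compatible canonical
toric procedure along the positive-dimensional monomial critical components · NOTE (critic): the
presentation is owed on a PROPER model, points at infinity included (at infinity unit × monomial
representatives appear; MonomialAt is unit-free) · ATTACKABLE (port) · T-hessian-1: CP2019 Rem 3.2 ∈
TameClass after one base blow-up + generator change] SRM₄ on the instances of dimension ≤ 3 or whose
extension K/L is in the TAME class (some generator's radicand is non-critical or pure monomial at
every closed point of some regular proper model -/
@[route_item "route-ResolutionOfSingularities-QuotientModels"]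
def TameRadicands : Prop :=
  ∀ p : ℕ, p.Prime → ∀ (k : Type) [Field k] [CharP k p] (L K : Type) [Field L] [Field K] [Algebra k L] [Algebra k K] [Algebra L K] [IsScalarTower k L K] (a : K), a ^ p ∈ (algebraMap L K).range → IntermediateField.adjoin L ({a} : Set K) = ⊤ → (∃ N : Literature.AlgebraicGeometry.Resolution.ProperModel.{0} k L, Literature.AlgebraicGeometry.Resolution.Scheme.IsRegular N.X) → ∀ M : Literature.AlgebraicGeometry.Resolution.ProperModel.{0} k K, topologicalKrullDim M.X ≤ 4 → (topologicalKrullDim M.X ≤ 3 ∨ Summit.ResolutionOfSingularities.ResolutionOfSingularities.Theorems.RadicandHessianClasses.TameClass p k L K) → ∃ M' : Literature.AlgebraicGeometry.Resolution.ProperModel.{0} k K, Literature.AlgebraicGeometry.Resolution.Scheme.IsRegular M'.X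

/-- item stmt-ResolutionOfSingularities-28912 · aside · rank 9 · open · by planner
sources: CossartPiltant2019, CossartJannsenSaito2020, Kato1994
[aside · piece 1 of the Hessian-rank cut of SRM₄ 27201 (lens-1 g5 HessianLadder rev 2; CRITIC rows
35 → 37 → 43) · RE-TAG ACCEPTED (row 43, lens-1 g6 IsolatedRadicands §A–§E checked line by line):
UNDECIDED(T-hyp-descent) → WEAKER(evidence: DECIDED-MOD-PORT function-field carving, standard
(e)(i)); T-hyp-descent DISCHARGED · ENGINE = NEW LEMMA: parafactorial 𝔪-primary descent (SGA 2 XI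
3.13–3.14 = tree Grothendieck1968_samuelConjecture_hypersurface) + cA-dictionary u₁u₂ = H with small
β-blow-ups driven by CJS Thm. 1.2 (tree CossartJannsenSaito2020SequencePermissible); no marked
ideals, no snc; supports HyperbolicSplitting (M) · MPrimaryReduction (S, PROVABLE NOW) ·
CompoundAResolution (L) · ParafactorialDescent (L) filed as asides · PORTS: CJS fact, SGA2 XI fact,
Liu 8.1.24, the row-37 TAME log port now consumed ON X∖{P_i} and required ISO OVER Reg X² (KKMS I §2
Thm 11 / CLS 11.1.9), schemes glue (properness local on the base) · leaf ATTACKABLE NOW = PROVER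
TARGET #6 of the cell (size L)] SRM₄ on the instances outside piece 0 whose extension K/L is in the
HYPERBOLIC class (menu enlarged by ISOLATED hyperbolic critical points: x − tᵖ ≡ y₀y₁ + q′(y₂,y₃)
mod 𝔪³). -/
@[route_item "route-ResolutionOfSingularities-QuotientModels"]
def HyperbolicRadicands : Prop :=
  ∀ p : ℕ, p.Prime → ∀ (k : Type) [Field k] [CharP k p] (L K : Type) [Field L] [Field K] [Algebra k L] [Algebra k K] [Algebra L K] [IsScalarTower k L K] (a : K), a ^ p ∈ (algebraMap L K).range → IntermediateField.adjoin L ({a} : Set K) = ⊤ → (∃ N : Literature.AlgebraicGeometry.Resolution.ProperModel.{0} k L, Literature.AlgebraicGeometry.Resolution.Scheme.IsRegular N.X) → ∀ M : Literature.AlgebraicGeometry.Resolution.ProperModel.{0} k K, topologicalKrullDim M.X ≤ 4 → ¬ (topologicalKrullDim M.X ≤ 3 ∨ Summit.ResolutionOfSingularities.ResolutionOfSingularities.Theorems.RadicandHessianClasses.TameClass p k L K) → Summit.ResolutionOfSingularities.ResolutionOfSingularities.Theorems.RadicandHessianClasses.HyperbolicClass p k L K → ∃ M' : Literature.AlgebraicGeometry.Resolution.ProperModel.{0}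 k K, Literature.AlgebraicGeometry.Resolution.Scheme.IsRegular M'.X

/-- item stmt-ResolutionOfSingularities-28913 · aside · rank 9 · open · by planner
sources: CossartPiltant2019, hauser2024, arXiv:2010.01517
[aside · piece 2 of the Hessian-rank cut of SRM₄ 27201 (lens-1 g5 HessianLadder rev 2; CRITIC rows
37 → 43) · UNDECIDED(test SHARPENED to T-rank1-log, desk/lit: log-resolution of an ISOLATED Zariski
threefold germ zᵖ = g(v₁,v₂,v₃) in a regular 4-space, ISO OFF THE POINT, snc SUPPORT only; end state
«at most one odd-multiplicity component of the total transform through any point», reached from a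
log-resolution of (C,T) by blowing up pairwise intersections of odd components) · DESCENT SEAM
CLOSED by the same parafactorial 𝔪-primary descent lemma (lens-1 g6 §D/§F, p odd: square completion
makes c a constant, char ≠ 2) · PARITY obstruction (§F) recorded · still inside «embedded resolution
of threefolds is open» (hauser2024 p.2), a located HARD seam ONE DIMENSION BELOW the core · for p =
2 the class adds nothing beyond piece 1 (even polar rank) · leaf IDEA-NEEDED] SRM₄ on the instances
outside pieces 0–1 whose extension K/L is in the RANK-ONE class (menu enlarged by isolated rank-one
critical points: x − tᵖ ≡ c·y₀² mod 𝔪³, c a unit). -/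
@[route_item "route-ResolutionOfSingularities-QuotientModels"]
def RankOneRadicands : Prop :=
  ∀ p : ℕ, p.Prime → ∀ (k : Type) [Field k] [CharP k p] (L K : Type) [Field L] [Field K] [Algebra k L] [Algebra k K] [Algebra L K] [IsScalarTower k L K] (a : K), a ^ p ∈ (algebraMap L K).range → IntermediateField.adjoin L ({a} : Set K) = ⊤ → (∃ N : Literature.AlgebraicGeometry.Resolution.ProperModel.{0} k L, Literature.AlgebraicGeometry.Resolution.Scheme.IsRegular N.X) → ∀ M : Literature.AlgebraicGeometry.Resolution.ProperModel.{0} k K, topologicalKrullDim M.X ≤ 4 → ¬ (topologicalKrullDim M.X ≤ 3 ∨ Summit.ResolutionOfSingularities.ResolutionOfSingularities.Theorems.RadicandHessianClasses.HyperbolicClass p k L K) → Summit.ResolutionOfSingularities.ResolutionOfSingularities.Theorems.RadicandHessianClasses.RankOneClass p k L K → ∃ M' : Literature.AlgebraicGeometry.Resolution.ProperModel.{0} k K, Literature.AlgebraicGeometry.Resolution.Scheme.IsRegular M'.X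

/-- item stmt-ResolutionOfSingularities-28914 · aside · rank 9 · open · by planner
sources: CossartPiltant2019, arXiv:2010.01517, arXiv:2311.16694
[aside · piece 3 = DECLARED RESIDUAL of the Hessian-rank cut of SRM₄ 27201 (lens-1 g5 HessianLadder
rev 2; CRITIC rows 37 → 43) · SPLIT BENEATH by critical DIMENSION (lens-1 g6 IsolatedRadicands, row
43): 28914 ⟺ IsolatedDegenerateRadicands ∧ NonIsolatedRadicands (kernel degenerateRadicands_iff,
Theorems/QuotientModelsIsolatedRadicands.lean) — IsolatedDegenerate UNDECIDED(T-iso-formal) located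
formal descent-free, NonIsolated the residual (score 0 conceded) · NOT ABSORBING: the hypothesis is
a universal negative (NO rank-one presentation on any regular proper model for any generator), so no
good instance is moved here by worsening a model · the held WILD BED (W–Q fW p = 2 rank 0
non-isolated; wildWQ:3:c52f rank 0) sits here AT ITS GIVEN MODELS, while CP2019 Rem 3.2 LEAVES it by
one base blow-up + generator change (T-hessian-1) · IDEA-NEEDED · INSTRUMENTABLE (T-hessian-2
endorsed)] SRM₄ on the extensions with no rank-one presentation (outside pieces 0–2). -/
@[route_item "route-ResolutionOfSingularities-QuotientModels"]
def DegenerateRadicands : Prop :=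
  ∀ p : ℕ, p.Prime → ∀ (k : Type) [Field k] [CharP k p] (L K : Type) [Field L] [Field K] [Algebra k L] [Algebra k K] [Algebra L K] [IsScalarTower k L K] (a : K), a ^ p ∈ (algebraMap L K).range → IntermediateField.adjoin L ({a} : Set K) = ⊤ → (∃ N : Literature.AlgebraicGeometry.Resolution.ProperModel.{0} k L, Literature.AlgebraicGeometry.Resolution.Scheme.IsRegular N.X) → ∀ M : Literature.AlgebraicGeometry.Resolution.ProperModel.{0} k K, topologicalKrullDim M.X ≤ 4 → ¬ (topologicalKrullDim M.X ≤ 3 ∨ Summit.ResolutionOfSingularities.ResolutionOfSingularities.Theorems.RadicandHessianClasses.HyperbolicClass p k L K) → ¬ Summit.ResolutionOfSingularities.ResolutionOfSingularities.Theorems.RadicandHessianClasses.RankOneClass p k L K → ∃ M' : Literature.AlgebraicGeometry.Resolution.ProperModel.{0} k K, Literature.AlgebraicGeometry.Resolution.Scheme.IsRegular M'.X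

/-- item stmt-ResolutionOfSingularities-29578 · aside · rank 9 · open · by planner
sources: CossartPiltant2019, CossartJannsenSaito2020
[aside] [TAGS · aside (outside the cone of QuotientModels.closes; NAMED-RUNG RULE) · node
IsolatedRadicands = lens-1 g6 (HOME/decomp-res-lens-1/g6/IsolatedRadicands.lean sha256 f78930fc) ·
CRITIC row 43 06:37Z «CLEARED AS CHILD NODE of 27201»; notions RadicandIsolatedClasses, kernels
QuotientModelsIsolatedRadicands] piece 3 of SRM₄ 27201 (split of the g5 residual 28914 by critical
DIMENSION; kernel degenerateRadicands_iff : 28914 ⟺ IsolatedDegenerate ∧ NonIsolated, PROVED) ·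
UNDECIDED(test: T-iso-formal; instrument T-hessian-2, kit) · WEAKER(evidence: restriction of SRM₄,
kernel isolatedDegenerateRadicands_of_srm4) · LOCATED + FORMAL + DESCENT-FREE: by the node's §A/§D
(parafactorial 𝔪-primary descent: «resolution near an isolated hypersurface point of dim ≥ 4 ⟺
projective resolution of the complete local ring iso off the point», banked) a statement about
finitely many complete local fourfold germs κ[[y,z]]/(zᵖ − f), f ∈ 𝔪³ isolated · COSTUME-RISK
DECLARED (dim-4 content at finitely many complete local rings; no weaker-in-difficulty claim) · leaf
IDEA-NEEDED. SRM₄ on the instances with NO rank-one presentation but SOME isolated presentation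
(binder shape = 28914 + IsolatedClass). -/
@[route_item "route-ResolutionOfSingularities-QuotientModels"]
def IsolatedDegenerateRadicands : Prop :=
  ∀ p : ℕ, p.Prime → ∀ (k : Type) [Field k] [CharP k p] (L K : Type) [Field L] [Field K] [Algebra k L] [Algebra k K] [Algebra L K] [IsScalarTower k L K] (a : K), a ^ p ∈ (algebraMap L K).range → IntermediateField.adjoin L ({a} : Set K) = ⊤ → (∃ N : Literature.AlgebraicGeometry.Resolution.ProperModel.{0} k L, Literature.AlgebraicGeometry.Resolution.Scheme.IsRegular N.X) → ∀ M : Literature.AlgebraicGeometry.Resolution.ProperModel.{0} k K, topologicalKrullDim M.X ≤ 4 → ¬ (topologicalKrullDim M.X ≤ 3 ∨ Summit.ResolutionOfSingularities.ResolutionOfSingularities.Theorems.RadicandHessianClasses.HyperbolicClass p k L K) → ¬ Summit.ResolutionOfSingularities.ResolutionOfSingularities.Theorems.RadicandHessianClasses.RankOneClass p k L K → Summit.ResolutionOfSingularities.ResolutionOfSingularities.Theorems.RadicandIsolatedClasses.IsolatedClass p k L K → ∃ M' : Literature.AlgebraicGeometry.Resolution.ProperModel.{0} k K, Literature.AlgebraicGeometry.Resolution.Scheme.IsRegular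 M'.X

/-- item stmt-ResolutionOfSingularities-29579 · aside · rank 9 · open · by planner
sources: CossartPiltant2019
[aside] [TAGS · aside (outside the cone of QuotientModels.closes; NAMED-RUNG RULE) · node
IsolatedRadicands = lens-1 g6 (HOME/decomp-res-lens-1/g6/IsolatedRadicands.lean sha256 f78930fc) ·
CRITIC row 43 06:37Z «CLEARED AS CHILD NODE of 27201»; notions RadicandIsolatedClasses, kernels
QuotientModelsIsolatedRadicands] piece 4 of SRM₄ 27201 = DECLARED RESIDUAL of the node (split of
28914) · residual-axis score 0 CONCEDED · WEAKER(evidence: restriction of SRM₄, kernel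
nonIsolatedRadicands_of_srm4) · NOT ABSORBING (critic ✓): the hypothesis is the universal negative
«no isolated presentation of any generator on any regular proper model» — IsolatedClass is a genuine
function-field class, not a dimension/degree slice; positive-dimensional non-monomial critical loci,
§D silent · holds the WILD BED at its given models (W–Q p = 2 rank 0 non-isolated; CP2019 Rem 3.2
leaves it by one base blow-up, T-hessian-1) · instrument T-hessian-2 decides whether generic towers
live here · leaf IDEA-NEEDED. SRM₄ on the extensions with no isolated presentation (binder shape =
28914 + ¬ IsolatedClass). -/
@[route_item "route-ResolutionOfSingularities-QuotientModels"]
def NonIsolatedRadicands : Prop :=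
  ∀ p : ℕ, p.Prime → ∀ (k : Type) [Field k] [CharP k p] (L K : Type) [Field L] [Field K] [Algebra k L] [Algebra k K] [Algebra L K] [IsScalarTower k L K] (a : K), a ^ p ∈ (algebraMap L K).range → IntermediateField.adjoin L ({a} : Set K) = ⊤ → (∃ N : Literature.AlgebraicGeometry.Resolution.ProperModel.{0} k L, Literature.AlgebraicGeometry.Resolution.Scheme.IsRegular N.X) → ∀ M : Literature.AlgebraicGeometry.Resolution.ProperModel.{0} k K, topologicalKrullDim M.X ≤ 4 → ¬ (topologicalKrullDim M.X ≤ 3 ∨ Summit.ResolutionOfSingularities.ResolutionOfSingularities.Theorems.RadicandHessianClasses.HyperbolicClass p k L K) → ¬ Summit.ResolutionOfSingularities.ResolutionOfSingularities.Theorems.RadicandHessianClasses.RankOneClass p k L K → ¬ Summit.ResolutionOfSingularities.ResolutionOfSingularities.Theorems.RadicandIsolatedClasses.IsolatedClass p k L K → ∃ M' : Literature.AlgebraicGeometry.Resolution.ProperModel.{0} k K, Literature.AlgebraicGeometry.Resolution.Scheme.IsRegular M'.X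

/-- item stmt-ResolutionOfSingularities-29580 · aside · rank 9 · open · by planner
sources: CossartJannsenSaito2020
[aside · SUPPORT refining QuotientModels.HyperbolicRadicands 28912 (attack content of lens-1 g6
IsolatedRadicands, HOME/decomp-res-lens-1/g6/IsolatedRadicands.lean sha256 f78930fc; CRITIC row 43
06:37Z «CLEARED AS CHILD NODE of 27201») · S4 · size M (formal algebra over Mathlib MvPowerSeries;
critic: «§B char-free splitting ✓ — the iteration ρ = Aα + Bβ + γ(Y₂,Y₃) is division-free, so incl.
p = 2») · leaf ATTACKABLE] Hyperbolic splitting lemma, formal, characteristic-free (§B): in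
κ[[X₀,…,X₃]], if f ≡ X₀X₁ + q(X₂,X₃) (mod 𝔪³) with q ∈ (X₂,X₃)², then f = u₁u₂ + h with
(u₁,u₂,X₂,X₃) a regular system of parameters and h a power series in X₂, X₃ alone. -/
@[route_item "route-ResolutionOfSingularities-QuotientModels"]
def HyperbolicSplitting : Prop :=
  ∀ (κ : Type) [Field κ] (f : MvPowerSeries (Fin 4) κ), f - MvPowerSeries.X 0 * MvPowerSeries.X 1 ∈ Ideal.span {(MvPowerSeries.X 2 : MvPowerSeries (Fin 4) κ), MvPowerSeries.X 3} ^ 2 ⊔ IsLocalRing.maximalIdeal (MvPowerSeries (Fin 4) κ) ^ 3 → ∃ (u₁ u₂ h : MvPowerSeries (Fin 4) κ), f = u₁ * u₂ + h ∧ Ideal.span {u₁, u₂, MvPowerSeries.X 2, MvPowerSeries.X 3} = IsLocalRing.maximalIdeal (MvPowerSeries (Fin 4) κ) ∧ ∀ n : Fin 4 →₀ ℕ, (n 0 ≠ 0 ∨ n 1 ≠ 0) → MvPowerSeries.coeff n h = 0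

/-- item stmt-ResolutionOfSingularities-29581 · aside · rank 9 · open · by planner
sources: EGAIV2
[aside · SUPPORT refining QuotientModels.HyperbolicRadicands 28912 (attack content of lens-1 g6
IsolatedRadicands, HOME/decomp-res-lens-1/g6/IsolatedRadicands.lean sha256 f78930fc; CRITIC row 43
06:37Z «CLEARED AS CHILD NODE of 27201») · S1 · size S/M, Mathlib-only, PROVABLE NOW (critic: «the
cell's FOURTH cheap real theorem (after 24578, 27821, 28256) — idle-prover target»; edge I = 0: f =
0, J = ⊤) · leaf ATTACKABLE NOW] 𝔪-primary reduction in a Noetherian local UFD (§D (3)): an ideal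
which is principal at every non-maximal prime is (principal) × (𝔪-primary or unit ideal) — gcd in
the UFD + Krull's principal ideal theorem. [folklore; cf. SGA 2 XI 3.10] -/
@[route_item "route-ResolutionOfSingularities-QuotientModels"]
def MPrimaryReduction : Prop :=
  ∀ (R : Type) [CommRing R] [IsDomain R] [IsNoetherianRing R] [IsLocalRing R] [UniqueFactorizationMonoid R] (I : Ideal R), (∀ (P : Ideal R) [P.IsPrime], ¬ P.IsMaximal → (I.map (algebraMap R (Localization.AtPrime P))).IsPrincipal) → ∃ (f : R) (J : Ideal R) (n : ℕ), I = Ideal.span {f} * J ∧ IsLocalRing.maximalIdeal R ^ n ≤ J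

/-- item stmt-ResolutionOfSingularities-29582 · aside · rank 9 · open · by planner
sources: CossartJannsenSaito2020, Hartshorne1977
[aside · SUPPORT refining QuotientModels.HyperbolicRadicands 28912 (attack content of lens-1 g6
IsolatedRadicands, HOME/decomp-res-lens-1/g6/IsolatedRadicands.lean sha256 f78930fc; CRITIC row 43
06:37Z «CLEARED AS CHILD NODE of 27201») · S2 · size L (chart computations of §C over the tree's
CentreSeq; consumes the tree fact CossartJannsenSaito2020SequencePermissible = CJS Thm. 1.2 on the
reduced excellent surface germ S = Spec B/(H) and the α/β blow-up dictionary; critic: «§C ✓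
(w-charts divide both u's ⇒ β-centres over the vertex; β iso over Reg by local factoriality;
u₁-chart graph regular since E regular); edge cases H unit / dim B ≤ 1 / dim B = 2 fine») · leaf
ATTACKABLE] The cA-dictionary: for a regular excellent local ring B of dimension ≤ 3 and 0 ≠ H ∈ B
with B/(H) regular off the closed point, the fourfold V = Spec B[u₁,u₂]/(u₁u₂ − H) is resolved by a
finite sequence of blow-ups (tree CentreSeq) all of whose centres lie over the non-regular locus of
V (= the vertex), with regular last scheme; no marked ideals, no snc. -/
@[route_item "route-ResolutionOfSingularities-QuotientModels"]
def CompoundAResolution : Prop :=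
  ∀ (B : Type) [CommRing B] [IsRegularLocalRing B] (H : B), Literature.AlgebraicGeometry.Resolution.IsExcellentRing B → ringKrullDim B ≤ 3 → H ≠ 0 → (∀ (Q : Ideal (B ⧸ Ideal.span {H})) [Q.IsPrime], ¬ Q.IsMaximal → IsRegularLocalRing (Localization.AtPrime Q)) → let V := AlgebraicGeometry.Spec (CommRingCat.of (MvPolynomial (Fin 2) B ⧸ Ideal.span {(MvPolynomial.X 0 * MvPolynomial.X 1 - MvPolynomial.C H : MvPolynomial (Fin 2) B)})); ∃ s : Literature.AlgebraicGeometry.Resolution.CentreSeq V, s.CentresOver (Literature.AlgebraicGeometry.Resolution.Scheme.regularLocus V)ᶜ ∧ Literature.AlgebraicGeometry.Resolution.Scheme.IsRegular s.top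

/-- item stmt-ResolutionOfSingularities-29583 · aside · rank 9 · open · by planner
sources: EGAIV2, Hartshorne1977
[aside · SUPPORT refining QuotientModels.HyperbolicRadicands 28912 (attack content of lens-1 g6
IsolatedRadicands, HOME/decomp-res-lens-1/g6/IsolatedRadicands.lean sha256 f78930fc; CRITIC row 43
06:37Z «CLEARED AS CHILD NODE of 27201») · S3 · size L (Mathlib AdicCompletion via
RadicandIsolatedClasses.HypersurfaceCompletion + tree CentreSeq; consumes the tree fact
Grothendieck1968_samuelConjecture_hypersurface.regular_codim_three = SGA 2 XI 3.13–3.14, Liu Thm.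
8.1.24, MPrimaryReduction, flat descent of regularity Matsumura 23.7; critic §D ✓ (Â UFD, Ŷ regular
+ integral, globalisation without patching); BANKED as a free-standing reduction for IsolatedCore /
lens-5 Iso₄ items) · leaf ATTACKABLE] Parafactorial 𝔪-primary descent (§D (1)–(4)): for a local
hypersurface ring A = R/(f) of dimension ≥ 4 (R regular local of dimension ≥ 5), excellent, regular
off the closed point, every blow-up sequence resolving the COMPLETION Â with centres over its
non-regular locus descends: Spec A has such a sequence too (in fact one blow-up of an 𝔪-primary
ideal). -/
@[route_item "route-ResolutionOfSingularities-QuotientModels"]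
def ParafactorialDescent : Prop :=
  ∀ (R : Type) [CommRing R] [IsRegularLocalRing R] (f : R), f ∈ IsLocalRing.maximalIdeal R → 5 ≤ ringKrullDim R → Literature.AlgebraicGeometry.Resolution.IsExcellentRing (R ⧸ Ideal.span {f}) → (∀ (Q : Ideal (R ⧸ Ideal.span {f})) [Q.IsPrime], ¬ Q.IsMaximal → IsRegularLocalRing (Localization.AtPrime Q)) → (∃ s : Literature.AlgebraicGeometry.Resolution.CentreSeq (AlgebraicGeometry.Spec (CommRingCat.of (Summit.ResolutionOfSingularities.ResolutionOfSingularities.Theorems.RadicandIsolatedClasses.HypersurfaceCompletion R f))), s.CentresOver (Literature.AlgebraicGeometry.Resolution.Scheme.regularLocus (AlgebraicGeometry.Spec (CommRingCat.of (Summit.ResolutionOfSingularities.ResolutionOfSingularities.Theorems.RadicandIsolatedClasses.HypersurfaceCompletion R f))))ᶜ ∧ Literature.AlgebraicGeometry.Resolution.Scheme.IsRegular s.top) → ∃ s : Literature.AlgebraicGeometry.Resolution.CentreSeq (AlgebraicGeometry.Spec (CommRingCat.of (R ⧸ Ideal.span {f}))), s.CentresOver (Literature.AlgebraicGeometry.Resolution.Scheme.regularLocus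 (AlgebraicGeometry.Spec (CommRingCat.of (R ⧸ Ideal.span {f}))))ᶜ ∧ Literature.AlgebraicGeometry.Resolution.Scheme.IsRegular s.top

/-- item stmt-ResolutionOfSingularities-29860 · aside · rank 9 · open · by planner
sources: doi:10.5802/aif.1575, arXiv:1508.06255, arXiv:1905.00872, Kollar2007
[TAGS · aside (outside the cone of QuotientModels.closes; NAMED-RUNG RULE) · node TameDistillation =
lens-6 g7 (HOME/decomp-res-lens-6/g7/TameDistillation.lean sha256 9bc5a9f3a3bbab78) · CRITIC row 45
06:58Z «CLEARED AS MAP NODE (residual 0 · decision 0 · map +1)» · refines E 27194: E ⟺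
PGroupFixedModels 27205 ∧ SylowDescent, EXACT (kernel
Theorems.QuotientModelsTameDistillation.galoisFixedModels_iff; the header's «Tame ∧ PGroup is NOT a
valid split» stands — this is the valid one) · NECESSARY (sylowDescent_of_root) · WEAKER than E by
letter (trivially true on p-groups, P = ⊤; 27205 trivially true on p′-groups — disjoint slices) ·
UNDECIDED vs E: STD (c) GLUE-TYPED (instance-wise «27205 output ⟹ E output»), credit 0, no engine
(Reynolds gives CM not regularity; visible route = equivariant model of K'^P + 27204 + the
non-Galois index step); on 𝒦_lin SD = ALL of E (Miyata) · leaf IDEA-NEEDED · census T-SD-1 desk]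
«coprime NON-normal descent under a Galois roof»: for every finite G acting on K'/k with a REGULAR
proper model N' to which the action extends and every Sylow p-subgroup P ≤ G: IF every presented
fixed field of P with a proper model has a regular proper model (= what PGroupF -/
@[route_item "route-ResolutionOfSingularities-QuotientModels"]
def SylowDescent : Prop :=
  ∀ p : ℕ, p.Prime → ∀ (k : Type) [Field k] [CharP k p] (K' : Type) [Field K'] [Algebra k K'] [Algebra.EssFiniteType k K'] (G : Type) [Group G] [Finite G] (ρ : G →* (K' ≃ₐ[k] K')) (N' : Literature.AlgebraicGeometry.Resolution.ProperModel k K'), Literature.AlgebraicGeometry.Resolution.Scheme.IsRegular N'.X → (∀ g : G, ∃ φ : N'.X ≅ N'.X, CategoryTheory.CategoryStruct.comp (AlgebraicGeometry.Spec.map (CommRingCat.ofHom (ρ g).toAlgHom.toRingHom)) N'.gen = CategoryTheory.CategoryStruct.comp N'.gen φ.hom) → ∀ (P : Sylow p G), (∀ (K₂ : Type) [Field K₂] [Algebra k K₂] [Algebra.EssFiniteType k K₂] (ι₂ : K₂ →ₐ[k] K'), (∀ y : K', y ∈ Set.range ι₂ ↔ ∀ g : G, g ∈ (P : Subgroup G)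 → ρ g y = y) → Nonempty (Literature.AlgebraicGeometry.Resolution.ProperModel k K₂) → ∃ N₂ : Literature.AlgebraicGeometry.Resolution.ProperModel k K₂, Literature.AlgebraicGeometry.Resolution.Scheme.IsRegular N₂.X) → ∀ (K : Type) [Field K] [Algebra k K] [Algebra.EssFiniteType k K] (ι : K →ₐ[k] K'), (∀ y : K', y ∈ Set.range ι ↔ ∀ g : G, ρ g y = y) → Nonempty (Literature.AlgebraicGeometry.Resolution.ProperModel k K) → ∃ N : Literature.AlgebraicGeometry.Resolution.ProperModel k K, Literature.AlgebraicGeometry.Resolution.Scheme.IsRegular N.X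

/-- item stmt-ResolutionOfSingularities-29861 · aside · rank 9 · open · by planner
sources: doi:10.5802/aif.1575, arXiv:1508.06255, arXiv:1905.00872, Kollar2007
[TAGS · aside (outside the cone; NAMED-RUNG RULE) · node TameDistillation (lens-6 g7, CRITIC row 45)
· FRAME = 27197 RegularModels on the PERFECT column (lens-5 N30 FieldColumns owns the imperfect
column) · NECESSARY (regModelsPerfect_of_root) · WEAKER than 27197 by the perfect column · UNDECIDED
· object of the EQUIV RECORD RegModelsPerfect ⟺ SepPPowerDescent mod the tree fact
Temkin2017PAlteration (kernel regModelsPerfect_iff_sepPPowerDescent)] every function field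
essentially of finite type over a PERFECT field of characteristic p with a proper model has a
REGULAR proper model. -/
@[route_item "route-ResolutionOfSingularities-QuotientModels", crux]
def RegModelsPerfect : Prop :=
  ∀ p : ℕ, p.Prime → ∀ (k : Type) [Field k] [CharP k p] [PerfectField k] (K : Type) [Field K] [Algebra k K] [Algebra.EssFiniteType k K], Nonempty (Literature.AlgebraicGeometry.Resolution.ProperModel k K) → ∃ N : Literature.AlgebraicGeometry.Resolution.ProperModel k K, Literature.AlgebraicGeometry.Resolution.Scheme.IsRegular N.X

/-- item stmt-ResolutionOfSingularities-29862 · aside · rank 9 · open · by planner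
sources: doi:10.5802/aif.1575, arXiv:1508.06255, arXiv:1905.00872, Kollar2007
[TAGS · aside (outside the cone; NAMED-RUNG RULE) · node TameDistillation (lens-6 g7, CRITIC row 45)
· refines 27197 · Temkin's residual after TAME DISTILLATION (Temkin 2017 Thm 1.2.5 = tree fact
Literature.AlgebraicGeometry.Resolution.Temkin2017PAlteration, used as a hypothesis only, KNOWN) ·
NECESSARY (sepPPowerDescent_of_root) · EQUIV to RegModelsPerfect mod Temkin2017PAlteration — an
EQUIV RECORD, declared COSTUME of the frame, not a bisection (critic ✓) · MAP CONTENT: on the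
perfect column the models half needs neither H 27195 nor the Galois/tame step (cross-links
galoisFixedModels_perfect_of_sepPPowerDescent, heightOneDescent_perfect_of_sepPPowerDescent);
sharpens lens-3 N15 SeparableDescent (any degree, over k̄) to separable p-POWER degree over every
perfect k · leaf IDEA-NEEDED (first rung: separable degree p; Galois sub-rung = non-equivariant
Artin–Schreier descent ⊇ WildQuotients 17942)] over a perfect field k of char p: if some proper
model N of K/k receives an ALTERATION φ : X₁ ⟶ N.X with X₁ REGULAR, of p-power degree (every prime
divisor of deg φ vanishes in k) and SEPARABLE, then K has a regular proper model — no group, no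
Galois hypothesis, no inseparable part, no ta -/
@[route_item "route-ResolutionOfSingularities-QuotientModels", crux]
def SepPPowerDescent : Prop :=
  ∀ p : ℕ, p.Prime → ∀ (k : Type) [Field k] [CharP k p] [PerfectField k] (K : Type) [Field K] [Algebra k K] [Algebra.EssFiniteType k K] (N : Literature.AlgebraicGeometry.Resolution.ProperModel k K) (X₁ : AlgebraicGeometry.Scheme.{0}) (φ : X₁ ⟶ N.X) (h : Literature.AlgebraicGeometry.Resolution.IsAlteration φ), Literature.AlgebraicGeometry.Resolution.Scheme.IsRegular X₁ → (∀ q : ℕ, q.Prime → q ∣ h.degree → (q : k) = 0) → h.IsSeparable → ∃ N' : Literature.AlgebraicGeometry.Resolution.ProperModel k K, Literature.AlgebraicGeometry.Resolution.Scheme.IsRegular N'.X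

/-- item stmt-ResolutionOfSingularities-30540 · aside · rank 9 · open · by planner
sources: Hartshorne1977, RudakovSafarevic1976, Kollar2007, CossartPiltant2019
[aside · refines 27195 H (HeightOneDescent) on its LOCATED class · FROBENIUS SANDWICH LADDER (lens-5
g8, CRITIC row 50 CLEARED AS MAP NODE): parameter = the sandwich exponent m of k(x₁..x₄) ⊇ K ⊇
k(xᵢ^{p^m}) · RUNG (4,1) = FIRST OPEN CELL of the (d, m) grid: every exponent-≤1 sandwich of
rational four-space has a regular proper k-model · contains the census rung RatIndexPDescentFour
(kernel ratIndexP_of_ratSandwich_one) and the hypersurface bed z^p + F over perfect k · NECESSARY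
mod port SandwichFieldsPort (RM 27197 ⟹ this, kernel ratSandwich_of_regularModels; ROOT ⟹ RM tree) ·
WEAKER than H / RM BY LETTER (function-field CLASS of an existence statement, std (b)/(e)(i)
admissible) · substance UNDECIDED (critic: étale-locally every H-germ is a sandwich germ ⇒
restriction is global only) · leaf IDEA-NEEDED (quotients of ℙ⁴ by p-closed foliations of any rank
at ADDITIVE points; barrier BaseOnlyRadicialNormalizationCannot) · INSTRUMENTABLE: T-FS-1 (kit,
staged) · m = 0 (K = k(x), ℙ⁴) is a KNOWN costume port and is not filed · why it might fail: an
additive-point foliation quotient of ℙ⁴ with no regular proper model] -/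
@[route_item "route-ResolutionOfSingularities-QuotientModels"]
def RatSandwichRegModelsFourOne : Prop :=
  Summit.ResolutionOfSingularities.ResolutionOfSingularities.Theorems.FrobeniusSandwichClasses.RatSandwichRegModels 4 1

/-- item stmt-ResolutionOfSingularities-30541 · aside · rank 9 · open · by planner
sources: Hartshorne1977, RudakovSafarevic1976, Kollar2007, CossartPiltant2019
[aside · refines 27195 · FROBENIUS SANDWICH LADDER rung (4,2) = the LOCATED ENVELOPE of the wild
models half: every exponent-≤2 sandwich k(x₁..x₄) ⊇ K ⊇ k(xᵢ^{p²}) has a regular proper model —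
contains EVERY held specimen (derivation bed, hypersurface beds z^{pᵉ} + F with e ≤ 2 incl. the
Moh-type M-rows written as k(y^{p²})(G(y)), models bed v2 rows purely inseparable in z) · ⟹
RatSandwichRegModelsFourOne (kernel ratSandwich_mono) · = FourOne + one application of the bridge
SandwichHeightOneDescentFour (kernel ratSandwich_succ_of_bridge through the p-radical closure
frobClosure: the Frobenius closure of an exponent-(m+1) sandwich is an exponent-m sandwich) ·
NECESSARY mod port · WEAKER by letter · substance UNDECIDED · ladder SELF-SIMILAR (rung m+1 = H on
rung-m fields) ⇒ no independent finite-range content beyond ℙ⁴ (critic) · desk T-FS-2 (M-rows as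
exponent-2 sandwiches, explicit G) · why it might fail: as FourOne, one Frobenius layer deeper
(Moh-type fields)] -/
@[route_item "route-ResolutionOfSingularities-QuotientModels"]
def RatSandwichRegModelsFourTwo : Prop :=
  Summit.ResolutionOfSingularities.ResolutionOfSingularities.Theorems.FrobeniusSandwichClasses.RatSandwichRegModels 4 2

/-- item stmt-ResolutionOfSingularities-30542 · aside · rank 9 · open · by planner
sources: Hartshorne1977, RudakovSafarevic1976, Kollar2007, CossartPiltant2019, Temkin2013
[aside · refines 27195 / H° 27696 on the rational bed · THE CENSUS RUNG RatH1D₄ (T-RR-rad-add-1,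
2026-08-30T05:12Z) TYPED: every index-p subfield K of k(x₁..x₄) containing k(x₁ᵖ..x₄ᵖ) —
equivalently (Jacobson) the kernel k(x)^δ of ONE p-closed rational vector field δ on 𝔸⁴ — has a
regular proper model · = H° ∩ (top = k(x)): the located intersection of MinimalHeight's index cut
and the sandwich class · located instances: the 386 CANDIDATE derivation quotients of census I32 · ⟸
RatSandwichRegModelsFourOne (kernel ratIndexP_of_ratSandwich_one) · NECESSARY mod port (kernel
ratIndexP_of_regularModels) · WEAKER by letter · substance UNDECIDED · IDEA-NEEDED (additive zeros
of δ; multiplicative zeros are toroidal) · INSTRUMENTABLE: T-FS-1 (resolve 𝔸⁴/δ for the candidate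
δ's: is Sing ⊆ image of the additive/nilpotent zero locus; does one δ-invariant blow-up sequence
make the zero scheme multiplicative-or-empty) · why it might fail: an additive p-closed derivation
on 𝔸⁴ whose quotient resists every base-only normalised blow-up (barrier
BaseOnlyRadicialNormalizationCannot)] -/
@[route_item "route-ResolutionOfSingularities-QuotientModels"]
def RatIndexPDescentFour : Prop :=
  Summit.ResolutionOfSingularities.ResolutionOfSingularities.Theorems.FrobeniusSandwichClasses.RatIndexPDescent 4

/-- item stmt-ResolutionOfSingularities-30543 · aside · rank 9 · open · by planner
sources: Hartshorne1977, RudakovSafarevic1976, Kollar2007, CossartPiltant2019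
[aside · refines 27195 · THE BRIDGE of the sandwich ladder = H RESTRICTED to sandwich pairs K ≤ K₁ ⊆
k(x₁..x₄), K₁ ∋ xᵢ^{p^m}, K₁ᵖ ⊆ K: a regular proper model of K₁ gives one of K · implication piece,
std (c), credit 0 (critic) · ⟸ H 27195 mod port (kernel sandwichDescent_of_heightOneDescent: H's
binders instantiated with the inclusion algebra, Frobenius-range from K₁ᵖ ⊆ K, finiteness from
SandwichFieldsPort) · with the KNOWN base rung m = 0 it gives EVERY rung and the asymptote (kernels
ratSandwich_all_of_zero, piu_of_zero_of_bridge) — the ladder is self-similar, so this IS the open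
core of the node: height-one descent from a regular model of an exponent-m sandwich (quotient by one
p-closed foliation; additive points) · NECESSARY mod port (kernel sandwichDescent_of_regularModels)
· WEAKER than H by letter (tops restricted to sandwiches), substance UNDECIDED; K1: HFS ⇏ H
(non-unirational K₁), no collapse · IDEA-NEEDED · why it might fail: exactly H's failure mode inside
k(x)] -/
@[route_item "route-ResolutionOfSingularities-QuotientModels"]
def SandwichHeightOneDescentFour : Prop :=
  Summit.ResolutionOfSingularities.ResolutionOfSingularities.Theorems.FrobeniusSandwichClasses.SandwichHeightOneDescent 4

/-- item stmt-ResolutionOfSingularities-30544 · aside · rank 9 · open · by planner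
sources: Hartshorne1977, RudakovSafarevic1976, Kollar2007, CossartPiltant2019
[aside · refines 27195 / RM 27197 · ASYMPTOTE of the sandwich ladder: every
purely-inseparably-unirational field k(x₁..x₄) ⊇ K ⊇ k(xᵢ^{p^m}) (some m) has a regular proper model
· EXACT limit: ⟺ ∀ m, RatSandwichRegModels 4 m (kernel piu_iff_forall_ratSandwich) · = base rung
(ℙ⁴, known) + bridge SandwichHeightOneDescentFour (kernel piu_of_zero_of_bridge) · NECESSARY mod
port (kernel piu_of_regularModels) · WEAKER than RM by letter (class restriction); substance
UNDECIDED · COMPLEMENT inside H / RM (tops NOT purely-inseparably unirational): NO located specimen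
in the cell — declared, UNLOCATED residual of H, score 0 · literature: sandwiches / Zariski surfaces
are a classical special class in dimension 2 only (Blass; Miyanishi–Ito; Rudakov–Šafarevič;
Hirokado, Liedtke); nothing in dimension ≥ 4 (lens + critic searches) · desk T-FS-3 (any exponent-1
sandwich resolution theorem in dim 3 independent of CossartPiltant2019?) · why it might fail: as the
rungs] -/
@[route_item "route-ResolutionOfSingularities-QuotientModels"]
def PIUnirationalRegModelsFour : Prop :=
  Summit.ResolutionOfSingularities.ResolutionOfSingularities.Theorems.FrobeniusSandwichClasses.PIUnirationalRegModels 4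

/-! D-0027 §2.1 — DECIDING THEOREM (planner-authored via `route open/edit --closes-file`; by planner-decomp-res-writer-1-g0-0 2026-08-30T03:58:59Z):
its hypotheses are this route's items and its conclusion the sub-problem Statement (glue_lint), and it elaborates with this file. -/

@[closes "route-ResolutionOfSingularities-QuotientModels"] theorem closes
    (hS : SandwichedResolve)
    (hC : GaloisTower) (hE : GaloisFixedModels) (hH : HeightOneDescent) :
    _root_.ResolutionOfSingularities := by
  classical
  -- (i) Zariski's regular models from the Galois tower: Galois step by `hE`, exponent-one links by `hH`.
  have hRM : ∀ p : ℕ, p.Prime → Literature.AlgebraicGeometry.Resolution.ProperModel.RegModel.{0} p := by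
    intro p hp k _ _ K _ _ _ _
    obtain ⟨K', _, _, _, G, _, _, ρ, N', K₁, ι, hN', hext, hfix, hfg₁, hM₁, -, -, -, hchain⟩ :=
      hC p hp k K
    have hA : ∀ E : IntermediateField k K',
        Relation.ReflTransGen
          (fun F E : IntermediateField k K' =>
            E ≤ F ∧ Algebra.EssFiniteType k E ∧ FiniteDimensional E K' ∧
              ∀ x : K', x ∈ F → x ^ p ∈ E)
          K₁ E →
        Algebra.EssFiniteType k E ∧
          ∃ N : Literature.AlgebraicGeometry.Resolution.ProperModel k E, Literature.AlgebraicGeometry.Resolution.Scheme.IsRegular N.X := by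
      intro E h
      induction h with
      | refl =>
        haveI := hfg₁
        refine ⟨hfg₁, hE p hp k K' G ρ N' hN' hext K₁ K₁.val (fun y => ?_) hM₁⟩
        rw [← hfix y]
        constructor
        · rintro ⟨x, rfl⟩
          exact x.2
        · intro hy
          exact ⟨⟨y, hy⟩, rfl⟩
      | @tail F E _ hFE ih =>
        obtain ⟨hfgF, NF, hNF⟩ := ih
        obtain ⟨hle, hfgE, hfin, hexp⟩ := hFE
        haveI := hfgF
        haveI := hfgE
        haveI := hfin
        letI : Algebra E F := (IntermediateField.inclusion hle).toRingHom.toAlgebra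
        haveI : IsScalarTower k E F := IsScalarTower.of_algebraMap_eq fun x => rfl
        let f : F →ₗ[E] K' :=
          { toFun := fun x => (x : K')
            map_add' := fun _ _ => rfl
            map_smul' := fun c x => by
              rw [RingHom.id_apply, Algebra.smul_def, RingHom.algebraMap_toAlgebra]
              rfl }
        haveI : Module.Finite E F := Module.Finite.of_injective f Subtype.val_injective
        have hexp' : ∀ x : F, x ^ p ∈ (algebraMap E F).range := fun x =>
          ⟨⟨(x : K') ^ p, hexp x x.2⟩, Subtype.ext rfl⟩
        exact ⟨hfgE, hH p hp k E F hexp' ⟨NF, hNF⟩⟩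
    obtain ⟨-, N₀, hN₀⟩ := hA _ hchain
    let e : K →ₐ[k] ι.fieldRange :=
      ι.codRestrict ι.fieldRange.toSubalgebra fun x => AlgHom.mem_fieldRange.mpr ⟨x, rfl⟩
    letI : Algebra K ι.fieldRange := e.toRingHom.toAlgebra
    haveI : IsScalarTower k K ι.fieldRange :=
      IsScalarTower.of_algebraMap_eq fun x => (e.commutes x).symm
    have hsurj : Function.Surjective (algebraMap K ι.fieldRange) := fun y => by
      obtain ⟨x, hx⟩ := AlgHom.mem_fieldRange.mp y.2
      exact ⟨x, Subtype.ext hx⟩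
    haveI : Module.Finite K ι.fieldRange :=
      Module.Finite.of_surjective (Algebra.linearMap K ι.fieldRange) hsurj
    exact hH p hp k K ι.fieldRange (fun y => RingHom.mem_range.mpr (hsurj _)) ⟨N₀, hN₀⟩
  -- (ii) an integral projective variety: join it (a projective model of its function field) with the
  -- regular model of (i); the join is sandwiched over the regular model, `hS` resolves it, push down.
  have hproj : ∀ {p : ℕ}, p.Prime → ∀ {k : Type} [Field k] [CharP k p] {n : ℕ} (X : AlgebraicGeometry.Scheme.{0})
      [AlgebraicGeometry.IsIntegral X] (ι : X ⟶ (Literature.AlgebraicGeometry.Motives.projectiveSpace n k).left) [AlgebraicGeometry.IsClosedImmersion ι],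
      Literature.AlgebraicGeometry.Resolution.Scheme.HasResolution X := by
    intro p hp k _ _ n X _ ι _
    haveI : AlgebraicGeometry.IsProper (Literature.AlgebraicGeometry.Motives.projectiveSpace n k).hom := Literature.AlgebraicGeometry.Motives.isProper_projectiveSpace n k
    let πX : X ⟶ AlgebraicGeometry.Spec (.of k) := CategoryTheory.CategoryStruct.comp ι (Literature.AlgebraicGeometry.Motives.projectiveSpace n k).hom
    have hpr : Literature.AlgebraicGeometry.Motives.IsProjectiveOver (CategoryTheory.Over.mk πX) := ⟨n, CategoryTheory.Over.homMk ι rfl, ‹_›⟩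
    haveI : AlgebraicGeometry.LocallyOfFiniteType πX := inferInstance
    obtain ⟨_, ⟨U', hU', rfl⟩, hηU, -⟩ := X.isBasis_affineOpens.exists_subset_of_mem_open
      (Set.mem_univ (genericPoint X)) isOpen_univ
    let U : X.Opens := U'
    have hU : AlgebraicGeometry.IsAffineOpen U := hU'
    haveI : AlgebraicGeometry.IsAffine U := hU
    haveI : Nonempty U := ⟨⟨_, hηU⟩⟩
    let A : Type := (U : AlgebraicGeometry.Scheme.{0}).presheaf.obj (Opposite.op ⊤)
    let g : (U : AlgebraicGeometry.Scheme.{0}) ⟶ AlgebraicGeometry.Spec (.of k) := CategoryTheory.CategoryStruct.comp U.ι πX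
    let ψ : k →+* A := g.appTop.hom.comp (AlgebraicGeometry.Scheme.ΓSpecIso (.of k)).inv.hom
    have hψ : ψ.FiniteType := by
      have h1 : g.appTop.hom.FiniteType :=
        (AlgebraicGeometry.HasRingHomProperty.iff_of_isAffine (P := @AlgebraicGeometry.LocallyOfFiniteType)).mp inferInstance
      exact h1.comp (RingHom.FiniteType.of_surjective _
        (AlgebraicGeometry.Scheme.ΓSpecIso (.of k)).symm.commRingCatIsoToRingEquiv.surjective)
    letI : Algebra k A := ψ.toAlgebra
    haveI hft : Algebra.FiniteType k A := hψ
    let K : Type := FractionRing A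
    let j : AlgebraicGeometry.Spec (.of A) ⟶ X := CategoryTheory.CategoryStruct.comp U.toScheme.isoSpec.inv U.ι
    have hj : CategoryTheory.CategoryStruct.comp j πX = AlgebraicGeometry.Spec.map (CommRingCat.ofHom (algebraMap k A)) := by
      change CategoryTheory.CategoryStruct.comp (CategoryTheory.CategoryStruct.comp U.toScheme.isoSpec.inv U.ι) πX = AlgebraicGeometry.Spec.map (CommRingCat.ofHom ψ)
      rw [CategoryTheory.Category.assoc, Literature.AlgebraicGeometry.Resolution.isoSpec_inv_comp]
      rfl
    let M₀ : Literature.AlgebraicGeometry.Resolution.ProjModel k K := Literature.AlgebraicGeometry.Resolution.ProjModel.ofChart (K := K) X πX hpr A j hj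
    haveI : Algebra.EssFiniteType k K := inferInstance
    let M : Literature.AlgebraicGeometry.Resolution.ProperModel k K := M₀.toProperModel
    obtain ⟨N, hN⟩ := hRM p hp k K ⟨M⟩
    let L : Literature.AlgebraicGeometry.Resolution.ProperModel k K := Literature.AlgebraicGeometry.Resolution.ProperModel.join M N
    let a : L.X ⟶ M.X := (Literature.AlgebraicGeometry.Resolution.ProperModel.joinFst M N).f
    let b : L.X ⟶ N.X := (Literature.AlgebraicGeometry.Resolution.ProperModel.joinSnd M N).f
    haveI : AlgebraicGeometry.IsProper a := Literature.AlgebraicGeometry.Resolution.ProperModel.Hom.isProper _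
    haveI : AlgebraicGeometry.IsProper b := Literature.AlgebraicGeometry.Resolution.ProperModel.Hom.isProper _
    have hres : Literature.AlgebraicGeometry.Resolution.Scheme.HasResolution L.X :=
      hS p hp k N.X N.π inferInstance inferInstance inferInstance hN L.X b inferInstance
        inferInstance inferInstance (Literature.AlgebraicGeometry.Resolution.ProperModel.Hom.isBirational _) inferInstance
    have hM : Literature.AlgebraicGeometry.Resolution.Scheme.HasResolution M.X :=
      Literature.AlgebraicGeometry.Resolution.ComponentGluing.Scheme.HasResolution.of_isBirational a (Literature.AlgebraicGeometry.Resolution.ProperModel.Hom.isBirational _) hres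
    exact hM
  -- (iii) reduction of `Literature.AlgebraicGeometry.Resolution.ResolutionInChar p` to the integral projective case.
  refine _root_.ResolutionOfSingularities_iff.mpr fun p hp => ?_
  intro k _ _ X f hs hl hq hr
  haveI : AlgebraicGeometry.QuasiCompact f := hq
  haveI : AlgebraicGeometry.LocallyOfFiniteType f := hl
  haveI : CompactSpace X := AlgebraicGeometry.QuasiCompact.compactSpace_of_compactSpace f
  obtain ⟨d, hd⟩ := Literature.AlgebraicGeometry.Resolution.exists_topologicalKrullDim_le_of_locallyOfFiniteType f
  refine (Literature.AlgebraicGeometry.Resolution.ResolutionOverUpToDim.of_projective (k := k) (d := d) fun m Y ι hι hY _ => ?_)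
    X f hs hl hq hr hd
  haveI := hι
  haveI := hY
  exact hproj hp Y ι

end Summit.ResolutionOfSingularities.ResolutionOfSingularities.Theses.QuotientModels
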